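import Literature.NumberTheory.LFunctions.MoebiusWalshTypeIIHighWalsh
import Literature.NumberTheory.LFunctions.MoebiusWalshTypeIIZero
import Literature.NumberTheory.LFunctions.MoebiusWalshTypeIIZeroBound
import Literature.NumberTheory.LFunctions.MoebiusWalshTypeIIZeroEval
import Literature.NumberTheory.LFunctions.LiouvilleWalshAssembly
import HarnessLib

/-!
# The type-II box estimate with a SHIFTED digit window, its closed form, the per-box type-II
# estimate for both windows, and the discharge of `bourgain_liouville_walsh_uniform`
# (Bourgain 2013, §2 (2.1)–(2.4), (2.23)–(2.31); Theorem 1 for `λ`)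

Topic `Literature/NumberTheory/LFunctions`; proofs (theorems, and ONE `def` with body,
`highPairFactor`, naming the explicit pair-count factor); no named fact. J. Bourgain, *Möbius–Walsh
correlation bounds and an estimate of Mauduit and Rivat*, J. Anal. Math. **119** (2013) 147–163
(= arXiv:1109.2784) [Bourgain2013MoebiusWalsh].

## Part 1 — the box estimate for the shifted windows `[K, K+σ)` (`σ = i + ρ + 1 + t`)

The companion of `MoebiusWalshTypeIIZero.boxSum_sq_typeII_zero_le` (window `K = 0`), assembled
out of the tree's layers exactly as there: (2.1)–(2.2) `|boxSum| ≤ ∑_a |∑_b β_b w_T(ab)|`,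
Cauchy–Schwarz over `a`, the bilinear van der Corput inequality `MoebiusWalsh.vdC_bilinear` with the
STRUCTURED lags `d·2^K`, `d < L = 2^ρ`; digit truncation
(`MoebiusWalshTypeII.natWalsh_mul_natWalsh_add_eq_window` with `2^K ∣ ad2^K`, the carry count
`card_filter_carry_le`) — `abs_sum_dyBlock_mul_le_trunc_high`, `sum_card_filter_carry_le_high`;
the substitution `w_{T'} ↦ W_{T'}` of Lemma 5 ((2.3)–(2.4),
`MoebiusWalsh.sum_abs_sum_natWalsh_mul_le_localised_add`); the expansion (2.8)/(2.11)
(`MoebiusWalsh.sum_abs_sum_localisedWalshRe_mul_le_pairSum`) and the evaluated pair count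
(2.23)–(2.28) (`MoebiusWalsh.pairSum_localised_le_explicit`): `boxSum_sq_typeII_high_le`, stated
SQUARED with the carry error, the substitution error and the factor `highPairFactor` explicit.

## Part 2 — the closed form

`highPairFactor` is evaluated under `L = 2^ρ` lags, `t ≤ ρ`, `K₁ = 2^{2ρ}`, `y = 2^{160ρ}`
(`y^{κ−1/2} ≤ 2^{−8ρ}` from `κ ≤ 9/20`, `MoebiusWalshTypeII.walshL1Exponent_le`), for
`60ρ ≤ i ≤ j`, `170ρ ≤ j`, `K ≤ j − 3ρ`, `10K ≥ 9i + 80ρ` (the paper's `K ≥ μ − ρ`, with the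
`ℓ¹`-loss `A₁² ≍ M^{2κ}` of the long arcs (2.24) explicit): `highPairFactor_le`
(`F ≤ 2^{17}D³(2^{−ρ} + 2^{165ρ}η²)`, `D = i+j+ρ+t+4`, `η = 2·2^{−c₂|T'|}`), whence
`boxSum_sq_typeII_high_bound`: `(boxSum T i j α β)² ≤ 4^{i+j}·2^{20}D³(2^{−t} + 2^{165ρ}η²)` — the
printed (2.29) for the shifted windows with all losses explicit (`carry_factor_le`,
`subst_error_le`, `high_bound_algebra`).

## Part 3 — the per-box type-II estimate and Theorem 1 for `λ`

`LiouvilleWalsh.bourgain_liouville_walsh_uniform_of_typeII` (tree) reduces Theorem 1 for `λ` to the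
per-box statement `hII`: `∑_{a ∈ D_i} |∑_{b ∈ D_j} β(b) w_T(ab)| ≤ (i+j+2)^C 2^{i+j}
(2^{-cρ} + 2^{Cρ-ci} + 2^{Cρ-c|T ∩ [K,K+i)|})` for `i ≤ j`, `ρ ≥ 1`, admissible `K` (`K = 0`, or
`i ≤ K + ρ`, `4ρ < K`), `K + ρ ≤ j`, `|β| ≤ 1`. `typeII_perBox` PROVES it (`c = 1/800`, `C = 16`)
from `boxSum_sq_typeII_zero_bound` (tree) and `boxSum_sq_typeII_high_bound`, run with
`ρ₀ = ⌊ρ/200⌋`, `t = ρ₀`, window `[K − 2ρ₀ − 1, K + i) ⊇ [K, K+i)`; when `ρ < 200` or `i < 12ρ` the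
claimed bound dominates the trivial `2^{i+j}`. Consequence:
**`Literature.NumberTheory.LFunctions.bourgain_liouville_walsh_uniform_holds`** — Bourgain's
Theorem 1 for the Liouville function as vendored in `MoebiusWalshCircuits.lean`.

No attempt is made to optimise any constant.

## References

* J. Bourgain, J. Anal. Math. 119 (2013) 147–163, §2 (2.1)–(2.4), (2.8)–(2.12), (2.23)–(2.31);
  Theorem 1 (remark on `λ`). [Bourgain2013MoebiusWalsh]
-/

noncomputable section

open Finset Real

namespace Literature.NumberTheory.LFunctions.MoebiusWalshTypeII


open Literature.NumberTheory.LFunctions.MoebiusWalshVaughan (natWalsh dyBlock mem_dyBlock boxSum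
  abs_natWalsh)
open Literature.NumberTheory.LFunctions.MoebiusWalsh (walshSupExponent walshL1Exponent
  vdC_bilinear localisedCoeff localisedWalshRe pairSum pairSum_localised_le_explicit
  sum_abs_sum_localisedWalshRe_mul_le_pairSum sum_abs_sum_natWalsh_mul_le_localised_add)
open Literature.NumberTheory.Sieve.Vinogradov (geomBound geomBound_nonneg)

/-! ### The explicit pair-count factor -/

/-- The factor `F` with `pairSum ≤ MN·F` of `MoebiusWalsh.pairSum_localised_le_explicit` (window of
`σ` digits above `K ≥ 1` untouched ones, `|T'| = s`, Lemma-5 parameter `K₁`, smooth variable of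
length `M`, long variable of length `N`, lags `≤ L`, threshold `y`, `2^σ ≤ L'M`):
`η²(4K₁+2)(2L + L'(1+log 2^σ)) + A₁²(130(I+2)/M + 8K₁/2^K + 4/N) + E·(2η²C_R[…] + 32C_R[…])`
(`η = 2·2^{-c₂ s}`, `A₁ = 4(K+2)2^{κσ}`, `I = log₂M`, `E = σ + log₂K₁ + 3`, `C_R = 4K₁L + 2`).
[cite: Bourgain2013MoebiusWalsh, (2.28)] -/
def highPairFactor (s K K₁ σ M N L : ℕ) (y L' : ℝ) : ℝ :=
  (2 * (2 : ℝ) ^ (-(walshSupExponent * s))) ^ 2 * (4 * K₁ + 2) *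
      (2 * L + L' * (1 + Real.log (2 ^ σ))) +
    (4 * ((K : ℝ) + 2) * (2 : ℝ) ^ (walshL1Exponent * σ)) ^ 2 *
      (130 * ((Nat.log 2 M : ℝ) + 2) / M + 8 * K₁ / 2 ^ K + 4 / N) +
    ((σ + Nat.log 2 K₁ + 3 : ℕ) : ℝ) *
      (2 * (2 * (2 : ℝ) ^ (-(walshSupExponent * s))) ^ 2 * (4 * K₁ * L + 2) *
          (((Nat.log 2 M : ℝ) + 2) * (5 * ((Nat.log 2 M : ℝ) + 2) * L' + 5 * y / N) * (2 * L' + 4 * y + 1) +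
            2 * ((Nat.log 2 M : ℝ) + 1) * L' * y) +
        32 * (4 * K₁ * L + 2) *
          (83 * ((Nat.log 2 M : ℝ) + 2) ^ 2 * L' ^ 2 * y ^ (walshL1Exponent - 1 / 2) +
            25 * ((Nat.log 2 M : ℝ) + 2) * (L' * M) ^ (2 * walshL1Exponent) / N +
            19 * ((Nat.log 2 M : ℝ) + 2) * L' * (L' * M) ^ walshL1Exponent / Real.sqrt N))

/-- `MoebiusWalsh.pairSum_localised_le_explicit` in terms of `highPairFactor`.
[cite: Bourgain2013MoebiusWalsh, (2.23)–(2.28)] -/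
theorem pairSum_le_highPairFactor {K σ K₁ : ℕ} (A : Finset (Fin (K + σ)))
    (hA : ∀ j ∈ A, K ≤ (j : ℕ)) (hK₁ : 1 ≤ K₁) (hKq : 4 * K₁ ≤ 2 ^ K) {M : ℕ} (hM : 0 < M)
    {d : ℕ} (hd : 1 ≤ d) {L : ℕ} (hdL : d ≤ L) {N₀ N : ℕ} (hN₀ : N₀ ≤ N)
    (hKN : 2 ^ K ≤ N) {y L' : ℝ} (hy : 1 ≤ y) (hL' : 1 ≤ L') (hσL : (2 : ℝ) ^ σ ≤ L' * M) :
    pairSum (fun k => ‖localisedCoeff K σ K₁ A k‖) (2 * (K₁ * 2 ^ σ)) M K σ d N₀ N ≤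
      M * N * highPairFactor A.card K K₁ σ M N L y L' :=
  pairSum_localised_le_explicit A hA hK₁ hKq hM hd hdL hN₀ hKN hy hL' hσL

/-- `highPairFactor ≥ 0` for `y ≥ 0`. [folklore] -/
theorem highPairFactor_nonneg (s K K₁ σ M N L : ℕ) {y : ℝ} (hy : 0 ≤ y) {L' : ℝ} (hL' : 0 ≤ L') :
    0 ≤ highPairFactor s K K₁ σ M N L y L' := by
  unfold highPairFactor
  have hlog : 0 ≤ Real.log ((2 : ℝ) ^ σ) := Real.log_nonneg (one_le_pow₀ (by norm_num))
  have : 0 ≤ y ^ (walshL1Exponent - 1 / 2) := Real.rpow_nonneg hy _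
  positivity

/-! ### The differenced sum after digit truncation, one structured lag `d·2^K` -/

/-- **One lag `d·2^K`, one `b`: truncation up to the carry exceptions** (shifted window). For
`d < 2^ρ`, with `w = i + ρ + 1 + K` and `T' = T ∩ [K, w + t)`:
`|∑_{a ∈ D_i} w_T(a(b+d2^K)) w_T(ab)| ≤ |∑_{a ∈ D_i} w_{T'}(a(b+d2^K)) w_{T'}(ab)| + 2 #{a ∈ D_i : ⌊ab/2^w⌋ ≡ -1 (2^t)}`.
[cite: Bourgain2013MoebiusWalsh, §2 (truncation after (2.2), "the K first digits remain")] -/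
theorem abs_sum_dyBlock_mul_le_trunc_high (T : Finset ℕ) (i ρ K t b : ℕ) {d : ℕ} (hd : d < 2 ^ ρ) :
    |∑ a ∈ dyBlock i, natWalsh T (a * (b + d * 2 ^ K)) * natWalsh T (a * b)| ≤
      |∑ a ∈ dyBlock i,
          natWalsh (T.filter fun j => K ≤ j ∧ j < (i + ρ + 1 + K) + t) (a * (b + d * 2 ^ K)) *
            natWalsh (T.filter fun j => K ≤ j ∧ j < (i + ρ + 1 + K) + t) (a * b)| +
        2 * ((dyBlock i).filter fun a => (a * b / 2 ^ (i + ρ + 1 + K)) % 2 ^ t = 2 ^ t - 1).card := by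
  set T' := T.filter fun j => K ≤ j ∧ j < (i + ρ + 1 + K) + t with hT'
  set F : ℕ → ℝ := fun a => natWalsh T (a * (b + d * 2 ^ K)) * natWalsh T (a * b) with hF
  set G : ℕ → ℝ := fun a => natWalsh T' (a * (b + d * 2 ^ K)) * natWalsh T' (a * b) with hG
  set Bad := (dyBlock i).filter fun a => (a * b / 2 ^ (i + ρ + 1 + K)) % 2 ^ t = 2 ^ t - 1 with hBad
  have hFG : ∀ a ∈ dyBlock i, a ∉ Bad → F a = G a := by
    intro a ha hbad
    have hgood : (a * b / 2 ^ (i + ρ + 1 + K)) % 2 ^ t ≠ 2 ^ t - 1 := by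
      intro h; exact hbad (Finset.mem_filter.2 ⟨ha, h⟩)
    have ha1 := (mem_dyBlock.1 ha).1
    have ha2 := (mem_dyBlock.1 ha).2
    have ha0 : 0 < a := lt_of_lt_of_le (Nat.two_pow_pos i) ha1
    have hδ : a * (d * 2 ^ K) < 2 ^ (i + ρ + 1 + K) := by
      calc a * (d * 2 ^ K) < a * (2 ^ ρ * 2 ^ K) :=
            mul_lt_mul_of_pos_left (Nat.mul_lt_mul_of_pos_right hd (Nat.two_pow_pos K)) ha0
        _ ≤ 2 ^ (i + 1) * (2 ^ ρ * 2 ^ K) := Nat.mul_le_mul_right _ ha2.le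
        _ = 2 ^ (i + ρ + 1 + K) := by rw [← pow_add, ← pow_add]; ring_nf
    have hdvd : 2 ^ K ∣ a * (d * 2 ^ K) := ⟨a * d, by ring⟩
    simp only [hF, hG]
    rw [show a * (b + d * 2 ^ K) = a * b + a * (d * 2 ^ K) by ring]
    exact natWalsh_mul_natWalsh_add_eq_window T hdvd hδ hgood
  have hdiff : ∀ a ∈ dyBlock i, |F a - G a| ≤ if a ∈ Bad then 2 else 0 := by
    intro a ha
    split_ifs with hbad
    · calc |F a - G a| ≤ |F a| + |G a| := abs_sub _ _
        _ ≤ 1 + 1 := by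
            simp only [hF, hG]
            rw [abs_mul, abs_mul, abs_natWalsh, abs_natWalsh, abs_natWalsh, abs_natWalsh]; norm_num
        _ = 2 := by norm_num
    · rw [hFG a ha hbad, sub_self, abs_zero]
  calc |∑ a ∈ dyBlock i, F a| = |∑ a ∈ dyBlock i, G a + ∑ a ∈ dyBlock i, (F a - G a)| := by
        rw [← Finset.sum_add_distrib]; congr 1; refine Finset.sum_congr rfl fun a _ => by ring
    _ ≤ |∑ a ∈ dyBlock i, G a| + |∑ a ∈ dyBlock i, (F a - G a)| := abs_add_le _ _
    _ ≤ |∑ a ∈ dyBlock i, G a| + ∑ a ∈ dyBlock i, |F a - G a| :=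
        add_le_add le_rfl (Finset.abs_sum_le_sum_abs _ _)
    _ ≤ |∑ a ∈ dyBlock i, G a| + ∑ a ∈ dyBlock i, (if a ∈ Bad then (2 : ℝ) else 0) :=
        add_le_add le_rfl (Finset.sum_le_sum hdiff)
    _ = |∑ a ∈ dyBlock i, G a| + 2 * (Bad.card : ℝ) := by
        rw [Finset.sum_ite_mem, Finset.sum_const, nsmul_eq_mul]
        congr 1
        rw [show dyBlock i ∩ Bad = Bad from Finset.inter_eq_right.2 (Finset.filter_subset _ _)]
        ring

/-- **The carry exceptions in a whole box** (shifted window): for the carry position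
`w = i + ρ + 1 + K`, `#{(a, b) ∈ D_i × D_j : ⌊ab/2^w⌋ ≡ -1 (2^t)} ≤ 2^i (2^j/2^{ρ+K+t} + 2)(2^{ρ+K+1} + 1)`.
[cite: Bourgain2013MoebiusWalsh, §2 (error term after (2.2))] -/
theorem sum_card_filter_carry_le_high (i j ρ K t : ℕ) :
    ∑ b ∈ dyBlock j, ((((dyBlock i).filter fun a => (a * b / 2 ^ (i + ρ + 1 + K)) % 2 ^ t = 2 ^ t - 1).card : ℕ) : ℝ) ≤
      2 ^ i * (((2 : ℝ) ^ j / 2 ^ (ρ + K + t) + 2) * (2 ^ (ρ + K + 1) + 1)) := by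
  have hswap : ∑ b ∈ dyBlock j,
      ((((dyBlock i).filter fun a => (a * b / 2 ^ (i + ρ + 1 + K)) % 2 ^ t = 2 ^ t - 1).card : ℕ) : ℝ) =
      ∑ a ∈ dyBlock i,
      ((((dyBlock j).filter fun b => (a * b / 2 ^ (i + ρ + 1 + K)) % 2 ^ t = 2 ^ t - 1).card : ℕ) : ℝ) := by
    simp only [Finset.card_filter]
    push_cast
    rw [Finset.sum_comm]
  rw [hswap]
  have hterm : ∀ a ∈ dyBlock i,
      ((((dyBlock j).filter fun b => (a * b / 2 ^ (i + ρ + 1 + K)) % 2 ^ t = 2 ^ t - 1).card : ℕ) : ℝ) ≤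
        ((2 : ℝ) ^ j / 2 ^ (ρ + K + t) + 2) * (2 ^ (ρ + K + 1) + 1) := by
    intro a ha
    rw [mem_dyBlock] at ha
    have ha0 : 0 < a := lt_of_lt_of_le (Nat.two_pow_pos i) ha.1
    have h := card_filter_carry_le ha0 (i + ρ + 1 + K) t (N₁ := 2 ^ j) (N₂ := 2 ^ (j + 1))
      (Nat.pow_le_pow_right (by norm_num) (Nat.le_succ j))
    rw [← dyBlock] at h
    refine h.trans ?_
    have haR : (2 : ℝ) ^ i ≤ a := by exact_mod_cast ha.1
    have haR' : (a : ℝ) ≤ 2 ^ (i + 1) := by exact_mod_cast ha.2.le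
    have h1 : ((2 : ℝ) ^ (j + 1) - 2 ^ j) * a / 2 ^ (i + ρ + 1 + K + t) ≤ 2 ^ j / 2 ^ (ρ + K + t) := by
      rw [show ((2 : ℝ) ^ (j + 1) - 2 ^ j) = 2 ^ j by rw [pow_succ]; ring]
      rw [div_le_div_iff₀ (by positivity) (by positivity)]
      calc (2 : ℝ) ^ j * a * 2 ^ (ρ + K + t) ≤ 2 ^ j * 2 ^ (i + 1) * 2 ^ (ρ + K + t) := by gcongr
        _ = 2 ^ j * 2 ^ (i + ρ + 1 + K + t) := by rw [mul_assoc, ← pow_add, ← pow_add]; ring_nf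
    have h2 : (2 : ℝ) ^ (i + ρ + 1 + K) / a ≤ 2 ^ (ρ + K + 1) := by
      rw [div_le_iff₀ (by positivity)]
      calc (2 : ℝ) ^ (i + ρ + 1 + K) = 2 ^ (ρ + K + 1) * 2 ^ i := by rw [← pow_add]; ring_nf
        _ ≤ 2 ^ (ρ + K + 1) * a := by gcongr
    push_cast at h1 ⊢
    have hA : 0 ≤ ((2 : ℝ) ^ (j + 1) - 2 ^ j) * a / 2 ^ (i + ρ + 1 + K + t) + 2 := by
      have : (0 : ℝ) ≤ (2 : ℝ) ^ (j + 1) - 2 ^ j := by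
        rw [pow_succ]; linarith [pow_pos (show (0:ℝ) < 2 by norm_num) j]
      positivity
    exact mul_le_mul (by linarith) (by linarith) (by positivity) (by positivity)
  calc ∑ a ∈ dyBlock i,
        ((((dyBlock j).filter fun b => (a * b / 2 ^ (i + ρ + 1 + K)) % 2 ^ t = 2 ^ t - 1).card : ℕ) : ℝ)
      ≤ ∑ _a ∈ dyBlock i, ((2 : ℝ) ^ j / 2 ^ (ρ + K + t) + 2) * (2 ^ (ρ + K + 1) + 1) := Finset.sum_le_sum hterm
    _ = 2 ^ i * (((2 : ℝ) ^ j / 2 ^ (ρ + K + t) + 2) * (2 ^ (ρ + K + 1) + 1)) := by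
        rw [Finset.sum_const, card_dyBlock, nsmul_eq_mul]; push_cast; ring

/-- The truncated digit set `T' = T ∩ [K, K+σ)` lies in `[K, K+σ)`. [folklore] -/
theorem mem_filter_window_high (T : Finset ℕ) (K w : ℕ) :
    (∀ x ∈ T.filter (fun j => K ≤ j ∧ j < w), x < w) ∧ (∀ x ∈ T.filter (fun j => K ≤ j ∧ j < w), K ≤ x) := by
  constructor
  · intro x hx; exact (Finset.mem_filter.1 hx).2.2
  · intro x hx; exact (Finset.mem_filter.1 hx).2.1

/-! ### The main theorem -/

set_option maxHeartbeats 1000000 in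
/-- **Type-II box estimate, shifted window `[K, K+σ)` (`K ≥ 1`), squared form** (Bourgain 2013,
§2, (2.1)–(2.4), (2.8)–(2.12), (2.23)–(2.28)). Let `T ⊆ ℕ` be a digit set, `ρ + K ≤ j`
(`L = 2^ρ` lags `d·2^K`; the short side is `i`), `t ∈ ℕ`, `σ = i + ρ + 1 + t`,
`T' = T ∩ [K, K+σ)`, `A' = T'.attachFin _`, `K₁ ≥ 2` with `4K₁ ≤ 2^K` (Lemma 5; so `K ≥ 3`), `y ≥ 1`,
`|α|, |β| ≤ 1`. Then
`(boxSum T i j α β)² ≤ 2^i · (2(2^j + 2^ρ2^K)/2^ρ) · [2^{i+j} + 2^ρ (2·ERR + SUB + 2^{i+j}·F)]`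
with the carry error `ERR = 2^i (2^j/2^{ρ+K+t} + 2)(2^{ρ+K+1} + 1)`, the substitution error
`SUB = 4 √(X(1+log X)³) √(((X+1)/2^{K+σ} + 2) 2^{K+σ}/(2(K₁−1)))`, `X = 2^{i+j+3}`, and the pair-count
factor `F = highPairFactor |A'| K K₁ σ 2^i 2^j 2^ρ y 2^{ρ+1+t}`.
[cite: Bourgain2013MoebiusWalsh, §2 (2.1)–(2.4), (2.23)–(2.28)] -/
theorem boxSum_sq_typeII_high_le (T : Finset ℕ) {i j ρ K t K₁ : ℕ} (hρKj : ρ + K ≤ j)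
    (hK₁ : 2 ≤ K₁) (hKq : 4 * K₁ ≤ 2 ^ K) (α β : ℕ → ℝ) (hα : ∀ a, |α a| ≤ 1) (hβ : ∀ b, |β b| ≤ 1)
    {y : ℝ} (hy : 1 ≤ y) :
    (boxSum T i j α β) ^ 2 ≤
      2 ^ i * (2 * ((2 : ℝ) ^ j + 2 ^ ρ * 2 ^ K) / 2 ^ ρ) *
        ((2 : ℝ) ^ i * 2 ^ j +
          2 ^ ρ *
            (2 * (2 ^ i * ((2 ^ j / 2 ^ (ρ + K + t) + 2) * (2 ^ (ρ + K + 1) + 1))) +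
              4 * Real.sqrt (((2 ^ (i + j + 3) : ℕ) : ℝ) * (1 + Real.log ((2 ^ (i + j + 3) : ℕ) : ℝ)) ^ 3) *
                Real.sqrt (((((2 ^ (i + j + 3) + 1 : ℕ)) : ℝ) / 2 ^ (K + (i + ρ + 1 + t)) + 2) *
                  (2 ^ (K + (i + ρ + 1 + t)) / (2 * ((K₁ : ℝ) - 1)))) +
              2 ^ i * 2 ^ j *
                highPairFactor
                  ((T.filter fun x => K ≤ x ∧ x < K + (i + ρ + 1 + t)).attachFin
                    (mem_filter_window_high T K (K + (i + ρ + 1 + t))).1).card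
                  K K₁ (i + ρ + 1 + t) (2 ^ i) (2 ^ j) (2 ^ ρ) y (2 ^ (ρ + 1 + t)))) := by
  set σ := i + ρ + 1 + t with hσ
  set T' := T.filter fun x => K ≤ x ∧ x < K + σ with hT'
  have hT'lt : ∀ x ∈ T', x < K + σ := (mem_filter_window_high T K (K + σ)).1
  have hT'K : ∀ x ∈ T', K ≤ x := (mem_filter_window_high T K (K + σ)).2
  set A' := T'.attachFin hT'lt with hA'
  set M : ℕ := 2 ^ i with hM
  set N : ℕ := 2 ^ j with hN
  set L : ℕ := 2 ^ ρ with hL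
  set R : ℕ := 2 ^ K with hR
  have hL0 : 0 < L := Nat.two_pow_pos ρ
  have hM0 : 0 < M := Nat.two_pow_pos i
  have hN0 : 0 < N := Nat.two_pow_pos j
  have hLR : L * R ≤ N := by
    rw [hL, hR, hN, ← pow_add]; exact Nat.pow_le_pow_right (by norm_num) hρKj
  have hRN : R ≤ N := le_trans (Nat.le_mul_of_pos_left R hL0) hLR
  have hMr : ((M : ℕ) : ℝ) = (2 : ℝ) ^ i := by rw [hM]; push_cast; ring
  have hNr : ((N : ℕ) : ℝ) = (2 : ℝ) ^ j := by rw [hN]; push_cast; ring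
  have hLr : ((L : ℕ) : ℝ) = (2 : ℝ) ^ ρ := by rw [hL]; push_cast; ring
  have hRr : ((R : ℕ) : ℝ) = (2 : ℝ) ^ K := by rw [hR]; push_cast; ring
  have hK₁' : 1 ≤ K₁ := by omega
  -- Step 1: drop `α`
  set S : ℕ → ℝ := fun a => ∑ b ∈ dyBlock j, β b * natWalsh T (a * b) with hS
  have h1 : |boxSum T i j α β| ≤ ∑ a ∈ dyBlock i, |S a| := by
    unfold boxSum
    refine (Finset.abs_sum_le_sum_abs _ _).trans (Finset.sum_le_sum fun a _ => ?_)
    have : ∑ b ∈ dyBlock j, α a * β b * natWalsh T (a * b) = α a * S a := by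
      rw [hS]; dsimp only; rw [Finset.mul_sum]
      exact Finset.sum_congr rfl fun b _ => by ring
    rw [this, abs_mul]
    calc |α a| * |S a| ≤ 1 * |S a| := mul_le_mul_of_nonneg_right (hα a) (abs_nonneg _)
      _ = |S a| := one_mul _
  -- Step 2: Cauchy–Schwarz
  have h2 : (∑ a ∈ dyBlock i, |S a|) ^ 2 ≤ M * ∑ a ∈ dyBlock i, (S a) ^ 2 := by
    have h := sq_sum_le_card_mul_sum_sq (s := dyBlock i) (f := fun a => |S a|)
    rw [card_dyBlock] at h
    simp only [sq_abs] at h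
    rw [hM]; exact_mod_cast h
  -- Step 3: van der Corput in `b` with lags `d·R`, `d < L`
  have h3 : ∑ a ∈ dyBlock i, (S a) ^ 2 ≤
      (2 * ((N : ℝ) + (L - 1 : ℕ) * (R : ℕ)) / L) *
        ∑ d ∈ range L, ∑ b ∈ Ico N (N + N),
          (if b + d * R < N + N then
            |∑ a ∈ dyBlock i, natWalsh T (a * (b + d * R)) * natWalsh T (a * b)| else 0) := by
    have hHR : (L - 1) * R ≤ N := le_trans (Nat.mul_le_mul_right _ (Nat.sub_le L 1)) hLR
    have hv := vdC_bilinear (fun a b => natWalsh T (a * b)) (β := β) (dyBlock i) (B₀ := N) (N := N)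
      (R := R) (H := L) hL0 hHR hβ
    have hD : dyBlock j = Ico N (N + N) := by rw [hN]; exact dyBlock_eq_Ico_add j
    simp only [hS, hD] at hv ⊢
    exact hv
  -- Step 4: one lag
  set Bad : ℕ → Finset ℕ := fun b =>
    (dyBlock i).filter fun a => (a * b / 2 ^ (i + ρ + 1 + K)) % 2 ^ t = 2 ^ t - 1 with hBad
  set ERRb : ℝ := ∑ b ∈ dyBlock j, (((Bad b).card : ℕ) : ℝ) with hERRb
  set X : ℕ := 2 ^ (i + j + 3) with hX
  set SUB : ℝ := 4 * Real.sqrt (X * (1 + Real.log X) ^ 3) *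
    Real.sqrt ((((X + 1 : ℕ) : ℝ) / 2 ^ (K + σ) + 2) * (2 ^ (K + σ) / (2 * ((K₁ : ℝ) - 1)))) with hSUB
  set F : ℝ := highPairFactor A'.card K K₁ σ M N L y (2 ^ (ρ + 1 + t)) with hF
  have hF0 : 0 ≤ F := highPairFactor_nonneg _ _ _ _ _ _ _ (by linarith) (by positivity)
  have hSUB0 : 0 ≤ SUB := by rw [hSUB]; positivity
  have hERRb0 : 0 ≤ ERRb := Finset.sum_nonneg fun b _ => Nat.cast_nonneg _
  have hERR : ERRb ≤ 2 ^ i * (((2 : ℝ) ^ j / 2 ^ (ρ + K + t) + 2) * (2 ^ (ρ + K + 1) + 1)) := by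
    rw [hERRb]; exact sum_card_filter_carry_le_high i j ρ K t
  clear_value SUB F ERRb
  have hMNF : 0 ≤ (M : ℝ) * N * F := by positivity
  have htot0 : 0 ≤ 2 * ERRb + SUB + M * N * F := by linarith
  -- the window filter of the truncation lemma is `T'`
  have hfilter : (T.filter fun x => K ≤ x ∧ x < (i + ρ + 1 + K) + t) = T' := by
    rw [hT']
    refine Finset.filter_congr fun x _ => ?_
    rw [hσ]; constructor <;> rintro ⟨h1, h2⟩ <;> exact ⟨h1, by omega⟩
  have hlag : ∀ d ∈ Ico 1 L, ∑ b ∈ Ico N (N + N), (if b + d * R < N + N then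
      |∑ a ∈ dyBlock i, natWalsh T (a * (b + d * R)) * natWalsh T (a * b)| else 0) ≤
      2 * ERRb + SUB + M * N * F := by
    intro d hd
    rw [Finset.mem_Ico] at hd
    have hdL : d < 2 ^ ρ := by rw [← hL]; exact hd.2
    have hD : Ico N (N + N) = dyBlock j := by rw [hN]; exact (dyBlock_eq_Ico_add j).symm
    -- drop the cut-off
    have hdrop : ∑ b ∈ Ico N (N + N), (if b + d * R < N + N then
        |∑ a ∈ dyBlock i, natWalsh T (a * (b + d * R)) * natWalsh T (a * b)| else 0) ≤
        ∑ b ∈ Ico N (N + N), |∑ a ∈ dyBlock i, natWalsh T (a * (b + d * R)) * natWalsh T (a * b)| := by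
      refine Finset.sum_le_sum fun b _ => ?_
      split_ifs
      · exact le_rfl
      · exact abs_nonneg _
    -- truncation
    have htrunc : ∑ b ∈ Ico N (N + N), |∑ a ∈ dyBlock i, natWalsh T (a * (b + d * R)) * natWalsh T (a * b)| ≤
        ∑ b ∈ Ico N (N + N), |∑ a ∈ dyBlock i, natWalsh T' (a * (b + d * 2 ^ K)) * natWalsh T' (a * b)| +
          2 * ERRb := by
      have hb : ∀ b ∈ Ico N (N + N), |∑ a ∈ dyBlock i, natWalsh T (a * (b + d * R)) * natWalsh T (a * b)| ≤
          |∑ a ∈ dyBlock i, natWalsh T' (a * (b + d * 2 ^ K)) * natWalsh T' (a * b)| +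
            2 * (((Bad b).card : ℕ) : ℝ) := by
        intro b _
        have h := abs_sum_dyBlock_mul_le_trunc_high T i ρ K t b hdL
        rw [hfilter] at h
        rw [hR]
        exact h
      refine (Finset.sum_le_sum hb).trans (le_of_eq ?_)
      rw [Finset.sum_add_distrib, ← Finset.mul_sum, hERRb, hD]
    -- substitution `w_{T'} ↦ W`
    have hXb : ∀ a ∈ dyBlock i, ∀ b ∈ Ico N (N + N), a * (b + d * 2 ^ K) ≤ X := by
      intro a ha b hb
      rw [mem_dyBlock] at ha
      rw [Finset.mem_Ico] at hb
      have hdR : d * 2 ^ K < N := by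
        calc d * 2 ^ K < L * R := by rw [hR]; exact Nat.mul_lt_mul_of_pos_right hd.2 (Nat.two_pow_pos K)
          _ ≤ N := hLR
      have hb' : b + d * 2 ^ K ≤ 4 * 2 ^ j := by rw [hN] at hb hdR; omega
      calc a * (b + d * 2 ^ K) ≤ 2 ^ (i + 1) * (4 * 2 ^ j) := Nat.mul_le_mul ha.2.le hb'
        _ = X := by rw [hX, pow_add, pow_add, pow_succ]; ring
    have hSa : ∀ a ∈ dyBlock i, 0 < a := fun a ha =>
      lt_of_lt_of_le (Nat.two_pow_pos i) (mem_dyBlock.1 ha).1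
    have hsubst := sum_abs_sum_natWalsh_mul_le_localised_add (K := K) (σ := σ) (K₁ := K₁) T' hT'lt hT'K
      hK₁ hKq (dyBlock i) hSa (B₀ := N) hN0 N (d * 2 ^ K) hXb
    -- the pair sum
    have hpair := sum_abs_sum_localisedWalshRe_mul_le_pairSum K σ K₁ A' d M M N N
    have hDi : dyBlock i = Ico M (M + M) := by rw [hM]; exact dyBlock_eq_Ico_add i
    rw [← hDi] at hpair
    have hexpl : pairSum (fun k => ‖localisedCoeff K σ K₁ A' k‖) (2 * (K₁ * 2 ^ σ)) M K σ d N N ≤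
        M * N * F := by
      have hA'K : ∀ jj ∈ A', K ≤ (jj : ℕ) := by
        intro jj hjj; rw [hA', Finset.mem_attachFin] at hjj; exact hT'K _ hjj
      have hσL : (2 : ℝ) ^ σ ≤ 2 ^ (ρ + 1 + t) * M := by
        rw [hMr, ← pow_add, hσ, show ρ + 1 + t + i = i + ρ + 1 + t by ring]
      have hKN : 2 ^ K ≤ N := by rw [hR] at hRN; exact hRN
      have h := pairSum_le_highPairFactor (K := K) (σ := σ) A' hA'K hK₁' hKq hM0 hd.1 hd.2.le
        (N₀ := N) (N := N) le_rfl hKN hy (one_le_pow₀ (by norm_num)) hσL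
      rw [hF]; exact h
    calc ∑ b ∈ Ico N (N + N), (if b + d * R < N + N then
          |∑ a ∈ dyBlock i, natWalsh T (a * (b + d * R)) * natWalsh T (a * b)| else 0)
        ≤ ∑ b ∈ Ico N (N + N), |∑ a ∈ dyBlock i, natWalsh T (a * (b + d * R)) * natWalsh T (a * b)| := hdrop
      _ ≤ ∑ b ∈ Ico N (N + N), |∑ a ∈ dyBlock i, natWalsh T' (a * (b + d * 2 ^ K)) * natWalsh T' (a * b)| +
            2 * ERRb := htrunc
      _ ≤ (∑ b ∈ Ico N (N + N), |∑ a ∈ dyBlock i, localisedWalshRe K σ K₁ A' (a * (b + d * 2 ^ K)) *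
            localisedWalshRe K σ K₁ A' (a * b)| + SUB) + 2 * ERRb := by
          refine add_le_add ?_ le_rfl
          rw [hSUB]; exact hsubst
      _ ≤ (M * N * F + SUB) + 2 * ERRb := by
          refine add_le_add (add_le_add (hpair.trans hexpl) le_rfl) le_rfl
      _ = 2 * ERRb + SUB + M * N * F := by ring
  -- Step 5: all lags
  have h4 : ∑ d ∈ range L, ∑ b ∈ Ico N (N + N),
        (if b + d * R < N + N then
          |∑ a ∈ dyBlock i, natWalsh T (a * (b + d * R)) * natWalsh T (a * b)| else 0) ≤
      (N : ℝ) * M + L * (2 * ERRb + SUB + M * N * F) := by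
    rw [Finset.range_eq_Ico, Finset.sum_eq_sum_Ico_succ_bot hL0]
    have h0 : ∑ b ∈ Ico N (N + N), (if b + 0 * R < N + N then
        |∑ a ∈ dyBlock i, natWalsh T (a * (b + 0 * R)) * natWalsh T (a * b)| else 0) = (N : ℝ) * M := by
      have : ∀ b ∈ Ico N (N + N), (if b + 0 * R < N + N then
          |∑ a ∈ dyBlock i, natWalsh T (a * (b + 0 * R)) * natWalsh T (a * b)| else 0) = (M : ℝ) := by
        intro b hb
        rw [Finset.mem_Ico] at hb
        rw [if_pos (by omega)]
        simp only [zero_mul, add_zero]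
        rw [Finset.sum_congr rfl fun a _ => natWalsh_mul_self T (a * b), Finset.sum_const, card_dyBlock,
          nsmul_eq_mul, mul_one, hM]
        push_cast
        exact abs_of_nonneg (by positivity)
      rw [Finset.sum_congr rfl this, Finset.sum_const, Nat.card_Ico, nsmul_eq_mul]
      congr 1; congr 1; omega
    rw [h0]
    have hrest : ∑ d ∈ Ico 1 L, ∑ b ∈ Ico N (N + N), (if b + d * R < N + N then
        |∑ a ∈ dyBlock i, natWalsh T (a * (b + d * R)) * natWalsh T (a * b)| else 0) ≤
        L * (2 * ERRb + SUB + M * N * F) := by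
      calc ∑ d ∈ Ico 1 L, ∑ b ∈ Ico N (N + N), (if b + d * R < N + N then
            |∑ a ∈ dyBlock i, natWalsh T (a * (b + d * R)) * natWalsh T (a * b)| else 0)
          ≤ ∑ _d ∈ Ico 1 L, (2 * ERRb + SUB + M * N * F) := Finset.sum_le_sum hlag
        _ = ((Ico 1 L).card : ℝ) * (2 * ERRb + SUB + M * N * F) := by rw [Finset.sum_const, nsmul_eq_mul]
        _ ≤ L * (2 * ERRb + SUB + M * N * F) := by
            refine mul_le_mul_of_nonneg_right ?_ htot0
            rw [Nat.card_Ico]; exact_mod_cast Nat.sub_le L 1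
    linarith
  -- Step 6: assemble
  have hfac : (2 * ((N : ℝ) + (L - 1 : ℕ) * (R : ℕ)) / L) ≤ 2 * ((2 : ℝ) ^ j + 2 ^ ρ * 2 ^ K) / 2 ^ ρ := by
    rw [hLr, hNr, hRr]
    refine div_le_div_of_nonneg_right ?_ (by positivity)
    have hL1 : ((L - 1 : ℕ) : ℝ) ≤ 2 ^ ρ := by
      rw [← hLr]; exact_mod_cast Nat.sub_le L 1
    have : (0 : ℝ) ≤ 2 ^ K := by positivity
    nlinarith
  have hsum0 : 0 ≤ ∑ d ∈ range L, ∑ b ∈ Ico N (N + N),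
        (if b + d * R < N + N then
          |∑ a ∈ dyBlock i, natWalsh T (a * (b + d * R)) * natWalsh T (a * b)| else 0) :=
    Finset.sum_nonneg fun d _ => Finset.sum_nonneg fun b _ => by split_ifs <;> positivity
  calc (boxSum T i j α β) ^ 2 = |boxSum T i j α β| ^ 2 := (sq_abs _).symm
    _ ≤ (∑ a ∈ dyBlock i, |S a|) ^ 2 := pow_le_pow_left₀ (abs_nonneg _) h1 2
    _ ≤ M * ∑ a ∈ dyBlock i, (S a) ^ 2 := h2
    _ ≤ M * ((2 * ((N : ℝ) + (L - 1 : ℕ) * (R : ℕ)) / L) *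
          ∑ d ∈ range L, ∑ b ∈ Ico N (N + N),
            (if b + d * R < N + N then
              |∑ a ∈ dyBlock i, natWalsh T (a * (b + d * R)) * natWalsh T (a * b)| else 0)) :=
        mul_le_mul_of_nonneg_left h3 (Nat.cast_nonneg M)
    _ ≤ M * ((2 * ((2 : ℝ) ^ j + 2 ^ ρ * 2 ^ K) / 2 ^ ρ) * ((N : ℝ) * M + L * (2 * ERRb + SUB + M * N * F))) := by
        refine mul_le_mul_of_nonneg_left ?_ (Nat.cast_nonneg M)
        have hrhs0 : 0 ≤ (N : ℝ) * M + L * (2 * ERRb + SUB + M * N * F) := by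
          have : 0 ≤ (L : ℝ) * (2 * ERRb + SUB + M * N * F) := mul_nonneg (Nat.cast_nonneg L) htot0
          positivity
        exact mul_le_mul hfac h4 hsum0 (by positivity)
    _ ≤ _ := by
        rw [hMr, ← mul_assoc]
        refine mul_le_mul_of_nonneg_left ?_ (by positivity)
        rw [hNr, hLr]
        refine add_le_add (le_of_eq (by ring)) ?_
        refine mul_le_mul_of_nonneg_left ?_ (by positivity)
        refine add_le_add (add_le_add ?_ ?_) ?_
        · exact mul_le_mul_of_nonneg_left hERR (by norm_num)
        · rw [hSUB, hX]
        · exact le_of_eq (by rw [hF])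



open Literature.NumberTheory.LFunctions.MoebiusWalshVaughan (natWalsh dyBlock boxSum)
open Literature.NumberTheory.LFunctions.MoebiusWalsh (walshSupExponent walshL1Exponent
  walshL1Exponent_pos walshL1Exponent_lt_half)

/-! ### Exponent bookkeeping (base `2`) -/

/-- `2^a / 2^b = 2^{a-b}` (`rpow`). [folklore] -/
theorem two_rpow_div_two_rpow (a b : ℝ) : (2 : ℝ) ^ a / (2 : ℝ) ^ b = (2 : ℝ) ^ (a - b) := by
  rw [Real.rpow_sub two_pos]

/-- `(2^a)^b = 2^{ab}` (`rpow`). [folklore] -/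
theorem two_rpow_rpow (a b : ℝ) : ((2 : ℝ) ^ a) ^ b = (2 : ℝ) ^ (a * b) := by
  rw [← Real.rpow_mul (by norm_num)]

/-- `√(2^n) = 2^{n/2}`. [folklore] -/
theorem sqrt_two_pow (n : ℕ) : Real.sqrt ((2 : ℝ) ^ n) = (2 : ℝ) ^ ((n : ℝ) / 2) := by
  rw [Real.sqrt_eq_rpow, two_pow_eq_rpow, two_rpow_rpow]; ring_nf

/-- `2^{2κσ} ≤ 2^{(9/10)σ}` (`κ ≤ 9/20`). [folklore] -/
theorem two_rpow_kappa_sq_le (σ : ℝ) (hσ : 0 ≤ σ) :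
    ((2 : ℝ) ^ (walshL1Exponent * σ)) ^ 2 ≤ (2 : ℝ) ^ ((9 / 10) * σ) := by
  rw [show ((2 : ℝ) ^ (walshL1Exponent * σ)) ^ 2 = ((2 : ℝ) ^ (walshL1Exponent * σ)) ^ ((2 : ℕ) : ℝ) by
    rw [Real.rpow_natCast], two_rpow_rpow]
  refine two_rpow_le_two_rpow ?_
  have := walshL1Exponent_le
  push_cast
  nlinarith

/-- `2^{κσ} ≤ 2^{(9/20)σ}`. [folklore] -/
theorem two_rpow_kappa_le (σ : ℝ) (hσ : 0 ≤ σ) :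
    (2 : ℝ) ^ (walshL1Exponent * σ) ≤ (2 : ℝ) ^ ((9 / 20) * σ) :=
  two_rpow_le_two_rpow (mul_le_mul_of_nonneg_right walshL1Exponent_le hσ)

/-- `y^{κ−1/2} ≤ 2^{−8ρ}` for `y = 2^{160ρ}`. [folklore] -/
theorem y_rpow_le (ρ : ℕ) :
    ((2 : ℝ) ^ (160 * ρ)) ^ (walshL1Exponent - 1 / 2) ≤ (2 : ℝ) ^ (-(8 * (ρ : ℝ))) := by
  rw [two_pow_eq_rpow, two_rpow_rpow]
  refine two_rpow_le_two_rpow ?_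
  have h1 := walshL1Exponent_le
  have hρ : (0 : ℝ) ≤ ρ := Nat.cast_nonneg ρ
  push_cast
  nlinarith


/-! ### The pair-count factor under the standard parameters -/

set_option maxHeartbeats 1000000 in
/-- **The explicit pair-count factor of the shifted window, evaluated.** With `L = 2^ρ` lags,
`t ≤ ρ`, `K₁ = 2^{2ρ}`, `σ = i + ρ + 1 + t`, `M = 2^i`, `N = 2^j`, `y = 2^{160ρ}`, `L' = 2^{ρ+1+t}`,
for `1 ≤ ρ`, `60ρ ≤ i ≤ j`, `170ρ ≤ j`, `K ≤ j`, `9i + 80ρ ≤ 10K`: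
`highPairFactor s K K₁ σ M N L y L' ≤ 2^{17} D³ (2^{-ρ} + 2^{165ρ} η²)`, `D = i + j + ρ + t + 4`,
`η = 2·2^{-c₂ s}`. Term by term: the diagonal (2.14) is `≤ 12 D 2^{4ρ} η²`; the long arcs (2.24)
`≤ 4544 D³ 2^{-4ρ}` (`A₁² ≤ 16(K+2)² 2^{0.9σ}` against `1/M`, `K₁/2^K`, `1/N`); the sup branch
(2.27) `≤ 1728 D³ 2^{165ρ} η²`; the Lemma-6 branch (2.25)–(2.26) `≤ 88320 D³ 2^{-ρ}`
(`y^{κ-1/2} ≤ 2^{-8ρ}`, `(L'M)^{2κ}/N ≤ 2^{0.9σ-j}`, `L'(L'M)^κ/√N ≤ 2^{2ρ+1+0.45σ-j/2}`).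
[cite: Bourgain2013MoebiusWalsh, (2.23)–(2.28)] -/
theorem highPairFactor_le (s K i j ρ t : ℕ) (hρ : 1 ≤ ρ) (htρ : t ≤ ρ) (hi : 60 * ρ ≤ i)
    (hij : i ≤ j) (hj : 170 * ρ ≤ j) (hKj : K ≤ j) (hK : 9 * i + 80 * ρ ≤ 10 * K) :
    highPairFactor s K (2 ^ (2 * ρ)) (i + ρ + 1 + t) (2 ^ i) (2 ^ j) (2 ^ ρ)
        ((2 : ℝ) ^ (160 * ρ)) ((2 : ℝ) ^ (ρ + 1 + t)) ≤
      2 ^ 17 * ((i : ℝ) + j + ρ + t + 4) ^ 3 *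
        (1 / 2 ^ ρ + 2 ^ (165 * ρ) * (2 * (2 : ℝ) ^ (-(walshSupExponent * s))) ^ 2) := by
  -- real abbreviations
  set D : ℝ := (i : ℝ) + j + ρ + t + 4 with hD
  set e : ℝ := (2 * (2 : ℝ) ^ (-(walshSupExponent * s))) ^ 2 with he
  set κ : ℝ := walshL1Exponent with hκ
  have hκ0 : 0 < κ := walshL1Exponent_pos
  have hκ9 : κ ≤ 9 / 20 := walshL1Exponent_le
  have hir : (0 : ℝ) ≤ i := Nat.cast_nonneg i
  have hjr : (0 : ℝ) ≤ j := Nat.cast_nonneg j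
  have hρr : (1 : ℝ) ≤ ρ := by exact_mod_cast hρ
  have htr : (0 : ℝ) ≤ t := Nat.cast_nonneg t
  have htρr : (t : ℝ) ≤ ρ := by exact_mod_cast htρ
  have hir60 : 60 * (ρ : ℝ) ≤ i := by exact_mod_cast hi
  have hijr : (i : ℝ) ≤ j := by exact_mod_cast hij
  have hjr170 : 170 * (ρ : ℝ) ≤ j := by exact_mod_cast hj
  have hKjr : (K : ℝ) ≤ j := by exact_mod_cast hKj
  have hKr : 9 * (i : ℝ) + 80 * ρ ≤ 10 * K := by exact_mod_cast hK
  have he0 : 0 ≤ e := by rw [he]; positivity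
  have hD4 : 4 ≤ D := by rw [hD]; linarith only [hir, hjr, hρr, htr]
  have hD0 : 0 < D := by linarith only [hD4]
  -- the casts inside `highPairFactor`
  have hlogM : Nat.log 2 (2 ^ i) = i := Nat.log_pow (by norm_num) i
  have hlogK : Nat.log 2 (2 ^ (2 * ρ)) = 2 * ρ := Nat.log_pow (by norm_num) _
  unfold highPairFactor
  rw [hlogM, hlogK, ← hκ, ← he]
  push_cast
  -- name the four terms' ingredients
  set σr : ℝ := (i : ℝ) + ρ + 1 + t with hσr
  have hσr0 : 0 ≤ σr := by rw [hσr]; positivity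
  have hσD : σr + 2 ≤ D := by rw [hσr, hD]; linarith only [hjr, hρr, htρr]
  have hiD : (i : ℝ) + 2 ≤ D := by rw [hD]; linarith only [hjr, hρr, htr]
  have hKD : (K : ℝ) + 2 ≤ D := by rw [hD]; linarith only [hKjr, hir, hρr, htr]
  have hED : σr + 2 * ρ + 3 ≤ D := by rw [hσr, hD]; linarith only [hjr170, hρr, htr]
  -- powers of two as `rpow`
  have h2ρ : (2 : ℝ) ^ ρ = (2 : ℝ) ^ (ρ : ℝ) := two_pow_eq_rpow ρ
  have hlog : 1 + Real.log ((2 : ℝ) ^ (i + ρ + 1 + t)) ≤ σr + 1 := by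
    have := one_add_log_two_pow_le (i + ρ + 1 + t); rw [hσr]; push_cast at this ⊢; linarith only [this]
  have hlog0 : 0 ≤ 1 + Real.log ((2 : ℝ) ^ (i + ρ + 1 + t)) := by
    have := Real.log_nonneg (one_le_pow₀ (M₀ := ℝ) one_le_two (n := i + ρ + 1 + t)); linarith only [this]
  -- base-2 bookkeeping: `z = 2^{-4ρ}`, `z ≤ 1/2^ρ`, `2^{3ρ} z = 1/2^ρ`
  set z : ℝ := (2 : ℝ) ^ (-(4 * (ρ : ℝ))) with hz
  have hz0 : 0 < z := by rw [hz]; positivity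
  have h2ρr : (0 : ℝ) < 2 ^ ρ := by positivity
  have hzρ : z ≤ 1 / 2 ^ ρ := by
    rw [hz, one_div, two_pow_eq_rpow, ← Real.rpow_neg (by norm_num)]
    exact two_rpow_le_two_rpow (by linarith only [hρr])
  have hz3 : (2 : ℝ) ^ (3 * ρ) * z = 1 / 2 ^ ρ := by
    rw [hz, one_div, two_pow_eq_rpow, two_pow_eq_rpow, ← Real.rpow_neg (by norm_num),
      two_rpow_mul_two_rpow]
    push_cast; ring_nf
  have hexp2z : ∀ a : ℝ, a ≤ 1 - 4 * ρ → (2 : ℝ) ^ a ≤ 2 * z := by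
    intro a ha
    calc (2 : ℝ) ^ a ≤ (2 : ℝ) ^ ((1 : ℝ) + -(4 * (ρ : ℝ))) := two_rpow_le_two_rpow (by linarith only [ha])
      _ = 2 * z := by rw [← two_rpow_mul_two_rpow, Real.rpow_one, hz]
  -- the `rpow` facts
  have hX : ((2 : ℝ) ^ (κ * σr)) ^ 2 ≤ (2 : ℝ) ^ ((9 / 10) * σr) := by rw [hκ]; exact two_rpow_kappa_sq_le σr hσr0
  have h2i : (2 : ℝ) ^ i = (2 : ℝ) ^ (i : ℝ) := two_pow_eq_rpow i
  have h2j : (2 : ℝ) ^ j = (2 : ℝ) ^ (j : ℝ) := two_pow_eq_rpow j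
  have h2K : (2 : ℝ) ^ K = (2 : ℝ) ^ (K : ℝ) := two_pow_eq_rpow K
  have hLM : (2 : ℝ) ^ (ρ + 1 + t) * 2 ^ i = (2 : ℝ) ^ σr := by
    rw [← pow_add, two_pow_eq_rpow, hσr]; push_cast; ring_nf
  -- T2 pieces: `2^{0.9σ}/2^i`, `2^{0.9σ} 2^{2ρ}/2^K`, `2^{0.9σ}/2^j ≤ 2z`
  have hT2a : (2 : ℝ) ^ ((9 / 10) * σr) / 2 ^ i ≤ 2 * z := by
    rw [h2i, two_rpow_div_two_rpow]; refine hexp2z _ ?_; rw [hσr]; linarith only [hir60, htρr]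
  have hT2b : (2 : ℝ) ^ ((9 / 10) * σr) * 2 ^ (2 * ρ) / 2 ^ K ≤ 2 * z := by
    rw [h2K, two_pow_eq_rpow (2 * ρ), two_rpow_mul_two_rpow, two_rpow_div_two_rpow]
    refine hexp2z _ ?_; rw [hσr]; push_cast; linarith only [hKr, htρr]
  have hT2c : (2 : ℝ) ^ ((9 / 10) * σr) / 2 ^ j ≤ 2 * z := by
    rw [h2j, two_rpow_div_two_rpow]; refine hexp2z _ ?_; rw [hσr]; linarith only [hijr, hjr170, htρr]
  -- T4 pieces
  have hL'le : (2 : ℝ) ^ (ρ + 1 + t) ≤ (2 : ℝ) ^ (2 * ρ + 1) := pow_le_pow_right₀ one_le_two (by omega)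
  have hT4a : ((2 : ℝ) ^ (ρ + 1 + t)) ^ 2 * ((2 : ℝ) ^ (160 * ρ)) ^ (κ - 1 / 2) ≤ 4 * z := by
    have h1 : ((2 : ℝ) ^ (ρ + 1 + t)) ^ 2 ≤ 4 * (2 : ℝ) ^ (4 * ρ) := by
      calc ((2 : ℝ) ^ (ρ + 1 + t)) ^ 2 ≤ ((2 : ℝ) ^ (2 * ρ + 1)) ^ 2 := pow_le_pow_left₀ (by positivity) hL'le 2
        _ = 4 * (2 : ℝ) ^ (4 * ρ) := by rw [← pow_mul, show (2 * ρ + 1) * 2 = 4 * ρ + 2 by ring, pow_add]; ring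
    have h2 : ((2 : ℝ) ^ (160 * ρ)) ^ (κ - 1 / 2) ≤ (2 : ℝ) ^ (-(8 * (ρ : ℝ))) := by rw [hκ]; exact y_rpow_le ρ
    have h3 : (2 : ℝ) ^ (4 * ρ) * (2 : ℝ) ^ (-(8 * (ρ : ℝ))) = z := by
      rw [two_pow_eq_rpow, two_rpow_mul_two_rpow, hz]; push_cast; ring_nf
    calc ((2 : ℝ) ^ (ρ + 1 + t)) ^ 2 * ((2 : ℝ) ^ (160 * ρ)) ^ (κ - 1 / 2)
        ≤ (4 * (2 : ℝ) ^ (4 * ρ)) * (2 : ℝ) ^ (-(8 * (ρ : ℝ))) :=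
          mul_le_mul h1 h2 (Real.rpow_nonneg (by positivity) _) (by positivity)
      _ = 4 * z := by rw [mul_assoc, h3]
  have hT4b : ((2 : ℝ) ^ (ρ + 1 + t) * 2 ^ i) ^ (2 * κ) / 2 ^ j ≤ 2 * z := by
    rw [hLM, two_rpow_rpow, h2j, two_rpow_div_two_rpow]
    have h1 : σr * (2 * κ) - j ≤ (9 / 10) * σr - j := by nlinarith only [hκ9, hσr0]
    refine (two_rpow_le_two_rpow h1).trans (hexp2z _ ?_)
    rw [hσr]; linarith only [hijr, hjr170, htρr]
  have hT4c : (2 : ℝ) ^ (ρ + 1 + t) * ((2 : ℝ) ^ (ρ + 1 + t) * 2 ^ i) ^ κ / Real.sqrt (2 ^ j) ≤ 2 * z := by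
    rw [hLM, two_rpow_rpow, sqrt_two_pow]
    have h1 : (2 : ℝ) ^ (ρ + 1 + t) ≤ (2 : ℝ) ^ ((2 * ρ + 1 : ℕ) : ℝ) := by rw [← two_pow_eq_rpow]; exact hL'le
    calc (2 : ℝ) ^ (ρ + 1 + t) * (2 : ℝ) ^ (σr * κ) / (2 : ℝ) ^ ((j : ℝ) / 2)
        ≤ (2 : ℝ) ^ ((2 * ρ + 1 : ℕ) : ℝ) * (2 : ℝ) ^ (σr * κ) / (2 : ℝ) ^ ((j : ℝ) / 2) := by
          gcongr
      _ = (2 : ℝ) ^ (((2 * ρ + 1 : ℕ) : ℝ) + σr * κ - (j : ℝ) / 2) := by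
          rw [two_rpow_mul_two_rpow, two_rpow_div_two_rpow]
      _ ≤ 2 * z := by
          refine hexp2z _ ?_
          have h2 : σr * κ ≤ (9 / 20) * σr := by nlinarith only [hκ9, hσr0]
          rw [hσr] at h2 ⊢; push_cast; linarith only [h2, hijr, hjr170, htρr, hρr]
  -- T3 pieces (natural powers only)
  have hy1 : (1 : ℝ) ≤ 2 ^ (160 * ρ) := one_le_pow₀ one_le_two
  have hL'y : (2 : ℝ) ^ (ρ + 1 + t) ≤ 2 ^ (160 * ρ) := pow_le_pow_right₀ one_le_two (by omega)
  have hyN : (2 : ℝ) ^ (160 * ρ) / 2 ^ j ≤ 1 := by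
    rw [div_le_one (by positivity)]; exact pow_le_pow_right₀ one_le_two (by omega)
  have hCR : 4 * (2 : ℝ) ^ (2 * ρ) * 2 ^ ρ + 2 ≤ 6 * 2 ^ (3 * ρ) := by
    have h1 : (2 : ℝ) ^ (2 * ρ) * 2 ^ ρ = 2 ^ (3 * ρ) := by rw [← pow_add]; ring_nf
    have h2 : (1 : ℝ) ≤ 2 ^ (3 * ρ) := one_le_pow₀ one_le_two
    rw [mul_assoc, h1]; linarith only [h2]
  have hCR0 : 0 ≤ 4 * (2 : ℝ) ^ (2 * ρ) * 2 ^ ρ + 2 := by positivity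
  have hLy : (2 : ℝ) ^ (ρ + 1 + t) * 2 ^ (160 * ρ) ≤ 2 * 2 ^ (162 * ρ) := by
    calc (2 : ℝ) ^ (ρ + 1 + t) * 2 ^ (160 * ρ) ≤ 2 ^ (2 * ρ + 1) * 2 ^ (160 * ρ) :=
          mul_le_mul_of_nonneg_right hL'le (by positivity)
      _ = 2 * 2 ^ (162 * ρ) := by rw [← pow_add, show 2 * ρ + 1 + 160 * ρ = 162 * ρ + 1 by ring, pow_succ]; ring
  have h3165 : (2 : ℝ) ^ (3 * ρ) * 2 ^ (162 * ρ) = 2 ^ (165 * ρ) := by rw [← pow_add]; ring_nf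
  -- term T1
  have hT1 : e * (4 * 2 ^ (2 * ρ) + 2) * (2 * 2 ^ ρ + 2 ^ (ρ + 1 + t) * (1 + Real.log (2 ^ (i + ρ + 1 + t)))) ≤
      12 * D * 2 ^ (4 * ρ) * e := by
    have h1 : 4 * (2 : ℝ) ^ (2 * ρ) + 2 ≤ 6 * 2 ^ (2 * ρ) := by
      have : (1 : ℝ) ≤ 2 ^ (2 * ρ) := one_le_pow₀ one_le_two; linarith only [this]
    have h2 : 2 * (2 : ℝ) ^ ρ ≤ 2 ^ (ρ + 1 + t) := by
      rw [show ρ + 1 + t = (ρ + 1) + t by ring, pow_add, pow_succ]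
      have : (1 : ℝ) ≤ 2 ^ t := one_le_pow₀ one_le_two
      have h0 : (0 : ℝ) ≤ 2 ^ ρ * 2 := by positivity
      nlinarith only [this, h0]
    have h3 : 2 * (2 : ℝ) ^ ρ + 2 ^ (ρ + 1 + t) * (1 + Real.log (2 ^ (i + ρ + 1 + t))) ≤ 2 ^ (ρ + 1 + t) * (σr + 2) := by
      have := mul_le_mul_of_nonneg_left hlog (by positivity : (0 : ℝ) ≤ 2 ^ (ρ + 1 + t))
      linarith only [this, h2]
    have h4 : (2 : ℝ) ^ (2 * ρ) * 2 ^ (ρ + 1 + t) ≤ 2 * 2 ^ (4 * ρ) := by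
      calc (2 : ℝ) ^ (2 * ρ) * 2 ^ (ρ + 1 + t) ≤ 2 ^ (2 * ρ) * 2 ^ (2 * ρ + 1) :=
            mul_le_mul_of_nonneg_left hL'le (by positivity)
        _ = 2 * 2 ^ (4 * ρ) := by rw [← pow_add, show 2 * ρ + (2 * ρ + 1) = 4 * ρ + 1 by ring, pow_succ]; ring
    have h30 : 0 ≤ 2 * (2 : ℝ) ^ ρ + 2 ^ (ρ + 1 + t) * (1 + Real.log (2 ^ (i + ρ + 1 + t))) := by positivity
    calc e * (4 * 2 ^ (2 * ρ) + 2) * (2 * 2 ^ ρ + 2 ^ (ρ + 1 + t) * (1 + Real.log (2 ^ (i + ρ + 1 + t))))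
        ≤ e * (6 * 2 ^ (2 * ρ)) * (2 ^ (ρ + 1 + t) * (σr + 2)) :=
          mul_le_mul (mul_le_mul_of_nonneg_left h1 he0) h3 h30 (by positivity)
      _ = 6 * e * (σr + 2) * (2 ^ (2 * ρ) * 2 ^ (ρ + 1 + t)) := by ring
      _ ≤ 6 * e * D * (2 * 2 ^ (4 * ρ)) := by
          refine mul_le_mul (mul_le_mul_of_nonneg_left hσD (by positivity)) h4 (by positivity) (by positivity)
      _ = 12 * D * 2 ^ (4 * ρ) * e := by ring
  -- term T2
  have hT2 : (4 * ((K : ℝ) + 2) * 2 ^ (κ * σr)) ^ 2 * (130 * ((i : ℝ) + 2) / 2 ^ i + 8 * 2 ^ (2 * ρ) / 2 ^ K + 4 / 2 ^ j) ≤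
      4544 * D ^ 3 * (1 / 2 ^ ρ) := by
    have h1 : (4 * ((K : ℝ) + 2) * 2 ^ (κ * σr)) ^ 2 ≤ 16 * D ^ 2 * (2 : ℝ) ^ ((9 / 10) * σr) := by
      rw [mul_pow, mul_pow]
      have hK2 : ((K : ℝ) + 2) ^ 2 ≤ D ^ 2 := pow_le_pow_left₀ (by positivity) hKD 2
      calc (4 : ℝ) ^ 2 * ((K : ℝ) + 2) ^ 2 * ((2 : ℝ) ^ (κ * σr)) ^ 2 ≤ 4 ^ 2 * D ^ 2 * (2 : ℝ) ^ ((9 / 10) * σr) := by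
            gcongr
        _ = 16 * D ^ 2 * (2 : ℝ) ^ ((9 / 10) * σr) := by norm_num
    have h2 : (2 : ℝ) ^ ((9 / 10) * σr) * (130 * ((i : ℝ) + 2) / 2 ^ i + 8 * 2 ^ (2 * ρ) / 2 ^ K + 4 / 2 ^ j) ≤
        (130 * D + 12) * (2 * z) := by
      have e1 : (2 : ℝ) ^ ((9 / 10) * σr) * (130 * ((i : ℝ) + 2) / 2 ^ i + 8 * 2 ^ (2 * ρ) / 2 ^ K + 4 / 2 ^ j) =
          130 * ((i : ℝ) + 2) * ((2 : ℝ) ^ ((9 / 10) * σr) / 2 ^ i) +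
            8 * ((2 : ℝ) ^ ((9 / 10) * σr) * 2 ^ (2 * ρ) / 2 ^ K) + 4 * ((2 : ℝ) ^ ((9 / 10) * σr) / 2 ^ j) := by ring
      rw [e1]
      have hi2 : 130 * ((i : ℝ) + 2) ≤ 130 * D := by linarith only [hiD]
      have t1 := mul_le_mul hi2 hT2a (by positivity) (by positivity)
      have t2 := mul_le_mul_of_nonneg_left hT2b (by norm_num : (0 : ℝ) ≤ 8)
      have t3 := mul_le_mul_of_nonneg_left hT2c (by norm_num : (0 : ℝ) ≤ 4)
      linarith only [t1, t2, t3]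
    have h0 : 0 ≤ 130 * ((i : ℝ) + 2) / 2 ^ i + 8 * 2 ^ (2 * ρ) / 2 ^ K + 4 / 2 ^ j := by positivity
    calc (4 * ((K : ℝ) + 2) * 2 ^ (κ * σr)) ^ 2 * (130 * ((i : ℝ) + 2) / 2 ^ i + 8 * 2 ^ (2 * ρ) / 2 ^ K + 4 / 2 ^ j)
        ≤ (16 * D ^ 2 * (2 : ℝ) ^ ((9 / 10) * σr)) * (130 * ((i : ℝ) + 2) / 2 ^ i + 8 * 2 ^ (2 * ρ) / 2 ^ K + 4 / 2 ^ j) :=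
          mul_le_mul_of_nonneg_right h1 h0
      _ = 16 * D ^ 2 * ((2 : ℝ) ^ ((9 / 10) * σr) * (130 * ((i : ℝ) + 2) / 2 ^ i + 8 * 2 ^ (2 * ρ) / 2 ^ K + 4 / 2 ^ j)) := by ring
      _ ≤ 16 * D ^ 2 * ((130 * D + 12) * (2 * z)) := mul_le_mul_of_nonneg_left h2 (by positivity)
      _ ≤ 16 * D ^ 2 * ((142 * D) * (2 * (1 / 2 ^ ρ))) := by
          refine mul_le_mul_of_nonneg_left (mul_le_mul (by linarith only [hD4]) (by linarith only [hzρ]) (by positivity) (by positivity)) (by positivity)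
      _ = 4544 * D ^ 3 * (1 / 2 ^ ρ) := by ring
  -- term T3 (without the factor `σ + 2ρ + 3`)
  have hT3 : 2 * e * (4 * 2 ^ (2 * ρ) * 2 ^ ρ + 2) *
      (((i : ℝ) + 2) * (5 * ((i : ℝ) + 2) * 2 ^ (ρ + 1 + t) + 5 * 2 ^ (160 * ρ) / 2 ^ j) *
          (2 * 2 ^ (ρ + 1 + t) + 4 * 2 ^ (160 * ρ) + 1) +
        2 * ((i : ℝ) + 1) * 2 ^ (ρ + 1 + t) * 2 ^ (160 * ρ)) ≤ 1728 * D ^ 2 * 2 ^ (165 * ρ) * e := by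
    set L' : ℝ := (2 : ℝ) ^ (ρ + 1 + t) with hL'
    set yy : ℝ := (2 : ℝ) ^ (160 * ρ) with hyy
    have hLy' : L' * yy ≤ 2 * 2 ^ (162 * ρ) := by rw [hL', hyy]; exact hLy
    clear_value L' yy
    have hL'1 : 1 ≤ L' := by rw [hL']; exact one_le_pow₀ one_le_two
    have hyy0 : 0 ≤ yy := by rw [hyy]; positivity
    have hL'0 : 0 ≤ L' := by linarith only [hL'1]
    have hi2 : (2 : ℝ) ≤ (i : ℝ) + 2 := by linarith only [hir]
    have hprod : (1 : ℝ) ≤ ((i : ℝ) + 2) * L' := by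
      have := mul_le_mul_of_nonneg_right hi2 hL'0; linarith only [this, hL'1]
    have h1 : 5 * ((i : ℝ) + 2) * L' + 5 * yy / 2 ^ j ≤ 10 * ((i : ℝ) + 2) * L' := by
      have : 5 * yy / 2 ^ j ≤ 5 := by rw [mul_div_assoc]; linarith only [hyN]
      linarith only [this, hprod]
    have h2 : 2 * L' + 4 * yy + 1 ≤ 7 * yy := by linarith only [hL'y, hy1]
    have h0 : 0 ≤ L' * yy := by positivity
    have h3 : 2 * ((i : ℝ) + 1) * L' * yy ≤ 2 * ((i : ℝ) + 2) ^ 2 * (L' * yy) := by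
      have h31 : (i : ℝ) + 1 ≤ ((i : ℝ) + 2) ^ 2 := by nlinarith only [hir]
      calc 2 * ((i : ℝ) + 1) * L' * yy = 2 * (((i : ℝ) + 1) * (L' * yy)) := by ring
        _ ≤ 2 * (((i : ℝ) + 2) ^ 2 * (L' * yy)) := by
            refine mul_le_mul_of_nonneg_left (mul_le_mul_of_nonneg_right h31 h0) (by norm_num)
        _ = 2 * ((i : ℝ) + 2) ^ 2 * (L' * yy) := by ring
    have h5 : ((i : ℝ) + 2) ^ 2 ≤ D ^ 2 := pow_le_pow_left₀ (by positivity) hiD 2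
    have hinner : ((i : ℝ) + 2) * (5 * ((i : ℝ) + 2) * L' + 5 * yy / 2 ^ j) * (2 * L' + 4 * yy + 1) +
        2 * ((i : ℝ) + 1) * L' * yy ≤ 72 * D ^ 2 * (L' * yy) := by
      have h4 : ((i : ℝ) + 2) * (5 * ((i : ℝ) + 2) * L' + 5 * yy / 2 ^ j) * (2 * L' + 4 * yy + 1) ≤
          ((i : ℝ) + 2) * (10 * ((i : ℝ) + 2) * L') * (7 * yy) := by
        refine mul_le_mul (mul_le_mul_of_nonneg_left h1 (by positivity)) h2 (by positivity) (by positivity)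
      calc ((i : ℝ) + 2) * (5 * ((i : ℝ) + 2) * L' + 5 * yy / 2 ^ j) * (2 * L' + 4 * yy + 1) +
            2 * ((i : ℝ) + 1) * L' * yy
          ≤ ((i : ℝ) + 2) * (10 * ((i : ℝ) + 2) * L') * (7 * yy) + 2 * ((i : ℝ) + 2) ^ 2 * (L' * yy) := add_le_add h4 h3
        _ = 72 * ((i : ℝ) + 2) ^ 2 * (L' * yy) := by ring
        _ ≤ 72 * D ^ 2 * (L' * yy) := by
            refine mul_le_mul_of_nonneg_right (mul_le_mul_of_nonneg_left h5 (by norm_num)) h0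
    calc 2 * e * (4 * 2 ^ (2 * ρ) * 2 ^ ρ + 2) *
          (((i : ℝ) + 2) * (5 * ((i : ℝ) + 2) * L' + 5 * yy / 2 ^ j) * (2 * L' + 4 * yy + 1) +
            2 * ((i : ℝ) + 1) * L' * yy)
        ≤ 2 * e * (6 * 2 ^ (3 * ρ)) * (72 * D ^ 2 * (L' * yy)) := by
          refine mul_le_mul (mul_le_mul_of_nonneg_left hCR (by positivity)) hinner (by positivity) (by positivity)
      _ = 864 * e * D ^ 2 * (2 ^ (3 * ρ) * (L' * yy)) := by ring
      _ ≤ 864 * e * D ^ 2 * (2 ^ (3 * ρ) * (2 * 2 ^ (162 * ρ))) := by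
          refine mul_le_mul_of_nonneg_left (mul_le_mul_of_nonneg_left hLy' (by positivity)) (by positivity)
      _ = 1728 * D ^ 2 * 2 ^ (165 * ρ) * e := by rw [← h3165]; ring
  -- term T4 (without the factor `σ + 2ρ + 3`)
  have hT4 : 32 * (4 * 2 ^ (2 * ρ) * 2 ^ ρ + 2) *
      (83 * ((i : ℝ) + 2) ^ 2 * ((2 : ℝ) ^ (ρ + 1 + t)) ^ 2 * ((2 : ℝ) ^ (160 * ρ)) ^ (κ - 1 / 2) +
          25 * ((i : ℝ) + 2) * ((2 : ℝ) ^ (ρ + 1 + t) * 2 ^ i) ^ (2 * κ) / 2 ^ j +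
        19 * ((i : ℝ) + 2) * 2 ^ (ρ + 1 + t) * ((2 : ℝ) ^ (ρ + 1 + t) * 2 ^ i) ^ κ / Real.sqrt (2 ^ j)) ≤
      67968 * D ^ 2 * (1 / 2 ^ ρ) := by
    have hbr : 83 * ((i : ℝ) + 2) ^ 2 * ((2 : ℝ) ^ (ρ + 1 + t)) ^ 2 * ((2 : ℝ) ^ (160 * ρ)) ^ (κ - 1 / 2) +
          25 * ((i : ℝ) + 2) * ((2 : ℝ) ^ (ρ + 1 + t) * 2 ^ i) ^ (2 * κ) / 2 ^ j +
        19 * ((i : ℝ) + 2) * 2 ^ (ρ + 1 + t) * ((2 : ℝ) ^ (ρ + 1 + t) * 2 ^ i) ^ κ / Real.sqrt (2 ^ j) ≤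
        354 * D ^ 2 * z := by
      have e1 : 83 * ((i : ℝ) + 2) ^ 2 * ((2 : ℝ) ^ (ρ + 1 + t)) ^ 2 * ((2 : ℝ) ^ (160 * ρ)) ^ (κ - 1 / 2) =
          83 * ((i : ℝ) + 2) ^ 2 * (((2 : ℝ) ^ (ρ + 1 + t)) ^ 2 * ((2 : ℝ) ^ (160 * ρ)) ^ (κ - 1 / 2)) := by ring
      have e2 : 25 * ((i : ℝ) + 2) * ((2 : ℝ) ^ (ρ + 1 + t) * 2 ^ i) ^ (2 * κ) / 2 ^ j =
          25 * ((i : ℝ) + 2) * (((2 : ℝ) ^ (ρ + 1 + t) * 2 ^ i) ^ (2 * κ) / 2 ^ j) := by ring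
      have e3 : 19 * ((i : ℝ) + 2) * 2 ^ (ρ + 1 + t) * ((2 : ℝ) ^ (ρ + 1 + t) * 2 ^ i) ^ κ / Real.sqrt (2 ^ j) =
          19 * ((i : ℝ) + 2) * ((2 : ℝ) ^ (ρ + 1 + t) * ((2 : ℝ) ^ (ρ + 1 + t) * 2 ^ i) ^ κ / Real.sqrt (2 ^ j)) := by ring
      rw [e1, e2, e3]
      have hi2D : ((i : ℝ) + 2) ^ 2 ≤ D ^ 2 := pow_le_pow_left₀ (by positivity) hiD 2
      have t1 := mul_le_mul (mul_le_mul_of_nonneg_left hi2D (by norm_num : (0 : ℝ) ≤ 83)) hT4a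
        (by positivity) (by positivity)
      have t2 := mul_le_mul (mul_le_mul_of_nonneg_left hiD (by norm_num : (0 : ℝ) ≤ 25)) hT4b
        (by positivity) (by positivity)
      have t3 := mul_le_mul (mul_le_mul_of_nonneg_left hiD (by norm_num : (0 : ℝ) ≤ 19)) hT4c
        (by positivity) (by positivity)
      have hDz : 88 * D * z ≤ 22 * D ^ 2 * z := by
        have := mul_nonneg (mul_nonneg hD0.le hz0.le) (sub_nonneg.2 hD4)
        nlinarith only [this]
      linarith only [t1, t2, t3, hDz]
    have hbr0 : 0 ≤ 83 * ((i : ℝ) + 2) ^ 2 * ((2 : ℝ) ^ (ρ + 1 + t)) ^ 2 * ((2 : ℝ) ^ (160 * ρ)) ^ (κ - 1 / 2) +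
          25 * ((i : ℝ) + 2) * ((2 : ℝ) ^ (ρ + 1 + t) * 2 ^ i) ^ (2 * κ) / 2 ^ j +
        19 * ((i : ℝ) + 2) * 2 ^ (ρ + 1 + t) * ((2 : ℝ) ^ (ρ + 1 + t) * 2 ^ i) ^ κ / Real.sqrt (2 ^ j) := by
      positivity
    calc 32 * (4 * 2 ^ (2 * ρ) * 2 ^ ρ + 2) *
          (83 * ((i : ℝ) + 2) ^ 2 * ((2 : ℝ) ^ (ρ + 1 + t)) ^ 2 * ((2 : ℝ) ^ (160 * ρ)) ^ (κ - 1 / 2) +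
              25 * ((i : ℝ) + 2) * ((2 : ℝ) ^ (ρ + 1 + t) * 2 ^ i) ^ (2 * κ) / 2 ^ j +
            19 * ((i : ℝ) + 2) * 2 ^ (ρ + 1 + t) * ((2 : ℝ) ^ (ρ + 1 + t) * 2 ^ i) ^ κ / Real.sqrt (2 ^ j))
        ≤ 32 * (6 * 2 ^ (3 * ρ)) * (354 * D ^ 2 * z) :=
          mul_le_mul (mul_le_mul_of_nonneg_left hCR (by norm_num)) hbr hbr0 (by positivity)
      _ = 67968 * D ^ 2 * (2 ^ (3 * ρ) * z) := by ring
      _ = 67968 * D ^ 2 * (1 / 2 ^ ρ) := by rw [hz3]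
  -- collect
  set P : ℝ := 1 / 2 ^ ρ with hP
  set Qe : ℝ := 2 ^ (165 * ρ) * e with hQe
  have hP0 : 0 ≤ P := by rw [hP]; positivity
  have hQe0 : 0 ≤ Qe := by rw [hQe]; positivity
  have hA : e * (4 * 2 ^ (2 * ρ) + 2) * (2 * 2 ^ ρ + 2 ^ (ρ + 1 + t) * (1 + Real.log (2 ^ (i + ρ + 1 + t)))) ≤
      12 * D ^ 3 * Qe := by
    refine hT1.trans ?_
    have h1 : D ≤ D ^ 3 := by
      have : 0 ≤ D * (D ^ 2 - 1) := mul_nonneg hD0.le (by nlinarith only [hD4])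
      nlinarith only [this]
    have h2 : (2 : ℝ) ^ (4 * ρ) ≤ 2 ^ (165 * ρ) := pow_le_pow_right₀ one_le_two (by omega)
    calc 12 * D * 2 ^ (4 * ρ) * e = 12 * (D * (2 ^ (4 * ρ) * e)) := by ring
      _ ≤ 12 * (D ^ 3 * (2 ^ (165 * ρ) * e)) := by
          refine mul_le_mul_of_nonneg_left (mul_le_mul h1 (mul_le_mul_of_nonneg_right h2 he0) (by positivity)
            (by positivity)) (by norm_num)
      _ = 12 * D ^ 3 * Qe := by rw [hQe]; ring
  have hT30 : 0 ≤ 2 * e * (4 * 2 ^ (2 * ρ) * 2 ^ ρ + 2) *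
      (((i : ℝ) + 2) * (5 * ((i : ℝ) + 2) * 2 ^ (ρ + 1 + t) + 5 * 2 ^ (160 * ρ) / 2 ^ j) *
          (2 * 2 ^ (ρ + 1 + t) + 4 * 2 ^ (160 * ρ) + 1) +
        2 * ((i : ℝ) + 1) * 2 ^ (ρ + 1 + t) * 2 ^ (160 * ρ)) := by positivity
  have hT40 : 0 ≤ 32 * (4 * 2 ^ (2 * ρ) * 2 ^ ρ + 2) *
      (83 * ((i : ℝ) + 2) ^ 2 * ((2 : ℝ) ^ (ρ + 1 + t)) ^ 2 * ((2 : ℝ) ^ (160 * ρ)) ^ (κ - 1 / 2) +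
          25 * ((i : ℝ) + 2) * ((2 : ℝ) ^ (ρ + 1 + t) * 2 ^ i) ^ (2 * κ) / 2 ^ j +
        19 * ((i : ℝ) + 2) * 2 ^ (ρ + 1 + t) * ((2 : ℝ) ^ (ρ + 1 + t) * 2 ^ i) ^ κ / Real.sqrt (2 ^ j)) := by
    positivity
  have hE0 : 0 ≤ σr + 2 * ρ + 3 := by positivity
  have hC : (σr + 2 * ρ + 3) *
      (2 * e * (4 * 2 ^ (2 * ρ) * 2 ^ ρ + 2) *
          (((i : ℝ) + 2) * (5 * ((i : ℝ) + 2) * 2 ^ (ρ + 1 + t) + 5 * 2 ^ (160 * ρ) / 2 ^ j) *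
              (2 * 2 ^ (ρ + 1 + t) + 4 * 2 ^ (160 * ρ) + 1) +
            2 * ((i : ℝ) + 1) * 2 ^ (ρ + 1 + t) * 2 ^ (160 * ρ)) +
        32 * (4 * 2 ^ (2 * ρ) * 2 ^ ρ + 2) *
          (83 * ((i : ℝ) + 2) ^ 2 * ((2 : ℝ) ^ (ρ + 1 + t)) ^ 2 * ((2 : ℝ) ^ (160 * ρ)) ^ (κ - 1 / 2) +
              25 * ((i : ℝ) + 2) * ((2 : ℝ) ^ (ρ + 1 + t) * 2 ^ i) ^ (2 * κ) / 2 ^ j +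
            19 * ((i : ℝ) + 2) * 2 ^ (ρ + 1 + t) * ((2 : ℝ) ^ (ρ + 1 + t) * 2 ^ i) ^ κ / Real.sqrt (2 ^ j))) ≤
      D * (1728 * D ^ 2 * Qe + 67968 * D ^ 2 * P) := by
    refine mul_le_mul hED ?_ (add_nonneg hT30 hT40) hD0.le
    refine add_le_add (hT3.trans (le_of_eq ?_)) hT4
    rw [hQe]; ring
  calc _ ≤ 12 * D ^ 3 * Qe + 4544 * D ^ 3 * P + D * (1728 * D ^ 2 * Qe + 67968 * D ^ 2 * P) :=
        add_le_add (add_le_add hA hT2) hC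
    _ = 72512 * (D ^ 3 * P) + 1740 * (D ^ 3 * Qe) := by ring
    _ ≤ 2 ^ 17 * (D ^ 3 * P) + 2 ^ 17 * (D ^ 3 * Qe) := by
        have h1 : 0 ≤ D ^ 3 * P := by positivity
        have h2 : 0 ≤ D ^ 3 * Qe := by positivity
        refine add_le_add (mul_le_mul_of_nonneg_right (by norm_num) h1) (mul_le_mul_of_nonneg_right (by norm_num) h2)
    _ = 2 ^ 17 * D ^ 3 * (P + Qe) := by ring
    _ = _ := by rw [hP, hQe]

/-! ### The carry and substitution errors under the standard parameters -/

/-- The carry factor: `(2^j/2^{ρ+K+t} + 2)(2^{ρ+K+1} + 1) ≤ 12·2^j/2^t` for `t ≤ ρ`, `1 ≤ ρ`,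
`K + 3ρ ≤ j`. [folklore] -/
theorem carry_factor_le {j ρ K t : ℕ} (hρ : 1 ≤ ρ) (htρ : t ≤ ρ) (hKj : K + 3 * ρ ≤ j) :
    ((2 : ℝ) ^ j / 2 ^ (ρ + K + t) + 2) * (2 ^ (ρ + K + 1) + 1) ≤ 12 * 2 ^ j / 2 ^ t := by
  have hA : (2 : ℝ) ^ j / 2 ^ (ρ + K + t) * 2 ^ (ρ + K + 1) = 2 * (2 ^ j / 2 ^ t) := by
    simp only [pow_add, pow_one]
    field_simp
  have hB : (2 : ℝ) ^ j / 2 ^ (ρ + K + t) ≤ 2 ^ j / 2 ^ t := by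
    refine div_le_div_of_nonneg_left (by positivity) (by positivity) ?_
    exact pow_le_pow_right₀ one_le_two (by omega)
  have hC : 2 * (2 : ℝ) ^ (ρ + K + 1) ≤ 2 * (2 ^ j / 2 ^ t) := by
    have : (2 : ℝ) ^ (ρ + K + 1) ≤ 2 ^ j / 2 ^ t := by
      rw [le_div_iff₀ (by positivity), ← pow_add]
      exact pow_le_pow_right₀ one_le_two (by omega)
    linarith only [this]
  have hDd : (2 : ℝ) ≤ 2 * (2 ^ j / 2 ^ t) := by
    have : (1 : ℝ) ≤ 2 ^ j / 2 ^ t := by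
      rw [le_div_iff₀ (by positivity), one_mul]; exact pow_le_pow_right₀ one_le_two (by omega)
    linarith only [this]
  have h0 : 0 ≤ (2 : ℝ) ^ j / 2 ^ t := by positivity
  calc ((2 : ℝ) ^ j / 2 ^ (ρ + K + t) + 2) * (2 ^ (ρ + K + 1) + 1)
      = (2 : ℝ) ^ j / 2 ^ (ρ + K + t) * 2 ^ (ρ + K + 1) + 2 ^ j / 2 ^ (ρ + K + t) + 2 * 2 ^ (ρ + K + 1) + 2 := by ring
    _ ≤ 2 * (2 ^ j / 2 ^ t) + 2 ^ j / 2 ^ t + 2 * (2 ^ j / 2 ^ t) + 2 * (2 ^ j / 2 ^ t) := by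
        rw [hA]; linarith only [hB, hC, hDd]
    _ = 7 * 2 ^ j / 2 ^ t := by ring
    _ ≤ 12 * 2 ^ j / 2 ^ t := by
        rw [mul_div_assoc, mul_div_assoc]; exact mul_le_mul_of_nonneg_right (by norm_num) h0

/-- `√(D³) ≤ D²/2` for `D ≥ 4`. [folklore] -/
theorem sqrt_cube_le {D : ℝ} (hD : 4 ≤ D) : Real.sqrt (D ^ 3) ≤ D ^ 2 / 2 := by
  have hD0 : 0 ≤ D := by linarith only [hD]
  rw [Real.sqrt_le_left (by positivity)]
  nlinarith only [hD, hD0, pow_nonneg hD0 3]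

set_option maxHeartbeats 1000000 in
/-- **The substitution error (2.4) under the standard parameters**: with `X = 2^{i+j+3}`,
`σ = i + ρ + 1 + t`, `K₁ = 2^{2ρ}` (`ρ ≥ 1`), `K + 3ρ ≤ j`, `t ≤ ρ`, `D = i + j + ρ + t + 4`:
`4√(X(1+log X)³) √(((X+1)/2^{K+σ} + 2) 2^{K+σ}/(2(K₁-1))) ≤ 23 D² 2^i 2^j / 2^ρ`.
[cite: Bourgain2013MoebiusWalsh, (2.4)] -/
theorem subst_error_le {i j ρ K t : ℕ} (hρ : 1 ≤ ρ) (htρ : t ≤ ρ) (hKj : K + 3 * ρ ≤ j) :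
    4 * Real.sqrt (((2 ^ (i + j + 3) : ℕ) : ℝ) * (1 + Real.log ((2 ^ (i + j + 3) : ℕ) : ℝ)) ^ 3) *
        Real.sqrt (((((2 ^ (i + j + 3) + 1 : ℕ)) : ℝ) / 2 ^ (K + (i + ρ + 1 + t)) + 2) *
          (2 ^ (K + (i + ρ + 1 + t)) / (2 * ((((2 ^ (2 * ρ) : ℕ)) : ℝ) - 1)))) ≤
      23 * ((i : ℝ) + j + ρ + t + 4) ^ 2 * 2 ^ i * 2 ^ j / 2 ^ ρ := by
  set D : ℝ := (i : ℝ) + j + ρ + t + 4 with hD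
  set X : ℝ := (2 : ℝ) ^ (i + j + 3) with hX
  have hX0 : 0 < X := by rw [hX]; positivity
  have hXc : (((2 ^ (i + j + 3) : ℕ)) : ℝ) = X := by rw [hX]; push_cast; ring
  have hX1c : ((((2 ^ (i + j + 3) + 1 : ℕ)) : ℝ)) = X + 1 := by rw [hX]; push_cast; ring
  have hK1c : ((((2 ^ (2 * ρ) : ℕ)) : ℝ)) = (2 : ℝ) ^ (2 * ρ) := by push_cast; ring
  rw [hXc, hX1c, hK1c]
  have hD4 : 4 ≤ D := by
    rw [hD]; have : (0:ℝ) ≤ i := Nat.cast_nonneg i; have : (0:ℝ) ≤ j := Nat.cast_nonneg j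
    have : (1:ℝ) ≤ ρ := by exact_mod_cast hρ
    have : (0:ℝ) ≤ t := Nat.cast_nonneg t
    linarith
  have hD0 : 0 < D := by linarith only [hD4]
  -- the first root
  have hlog : 1 + Real.log X ≤ D := by
    have := one_add_log_two_pow_le (i + j + 3)
    rw [hX, hD]; push_cast at this ⊢
    have : (0:ℝ) ≤ ρ := Nat.cast_nonneg ρ; have : (0:ℝ) ≤ t := Nat.cast_nonneg t
    linarith
  have hlog0 : 0 ≤ 1 + Real.log X := by
    rw [hX]; have := Real.log_nonneg (one_le_pow₀ (M₀ := ℝ) one_le_two (n := i + j + 3)); linarith only [this]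
  have h1 : Real.sqrt (X * (1 + Real.log X) ^ 3) ≤ Real.sqrt X * (D ^ 2 / 2) := by
    calc Real.sqrt (X * (1 + Real.log X) ^ 3) ≤ Real.sqrt (X * D ^ 3) := by
          refine Real.sqrt_le_sqrt (mul_le_mul_of_nonneg_left ?_ hX0.le)
          exact pow_le_pow_left₀ hlog0 hlog 3
      _ = Real.sqrt X * Real.sqrt (D ^ 3) := Real.sqrt_mul hX0.le _
      _ ≤ Real.sqrt X * (D ^ 2 / 2) := mul_le_mul_of_nonneg_left (sqrt_cube_le hD4) (Real.sqrt_nonneg _)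
  -- the second root
  set P2 : ℝ := (2 : ℝ) ^ (K + (i + ρ + 1 + t)) with hP2
  have hP20 : 0 < P2 := by rw [hP2]; positivity
  have hK₁2 : (2 : ℝ) ≤ 2 ^ (2 * ρ) := by
    calc (2 : ℝ) = 2 ^ 1 := by norm_num
      _ ≤ 2 ^ (2 * ρ) := pow_le_pow_right₀ one_le_two (by omega)
  have hP2X : 1 + 2 * P2 ≤ X := by
    have h2 : 2 * P2 ≤ (2 : ℝ) ^ (i + j + 2) := by
      rw [hP2, show (2 : ℝ) * 2 ^ (K + (i + ρ + 1 + t)) = 2 ^ (K + (i + ρ + 1 + t) + 1) by rw [pow_succ]; ring]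
      exact pow_le_pow_right₀ one_le_two (by omega)
    have h3 : (1 : ℝ) ≤ 2 ^ (i + j + 2) := one_le_pow₀ one_le_two
    have h4 : X = 2 * (2 : ℝ) ^ (i + j + 2) := by rw [hX, pow_succ]; ring
    linarith only [h2, h3, h4]
  have h2 : ((X + 1) / P2 + 2) * (P2 / (2 * ((2 : ℝ) ^ (2 * ρ) - 1))) ≤ 2 * X / 2 ^ (2 * ρ) := by
    have e1 : ((X + 1) / P2 + 2) * (P2 / (2 * ((2 : ℝ) ^ (2 * ρ) - 1))) = (X + 1 + 2 * P2) / (2 * ((2 : ℝ) ^ (2 * ρ) - 1)) := by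
      field_simp
    rw [e1, div_le_div_iff₀ (by linarith only [hK₁2]) (by positivity)]
    have h5 : X + 1 + 2 * P2 ≤ 2 * X := by linarith only [hP2X]
    have h6 : (2 : ℝ) ^ (2 * ρ) ≤ 2 * (2 ^ (2 * ρ) - 1) := by linarith only [hK₁2]
    calc (X + 1 + 2 * P2) * (2 : ℝ) ^ (2 * ρ) ≤ (2 * X) * (2 ^ (2 * ρ)) :=
          mul_le_mul_of_nonneg_right h5 (by positivity)
      _ ≤ (2 * X) * (2 * (2 ^ (2 * ρ) - 1)) := mul_le_mul_of_nonneg_left h6 (by positivity)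
  have h3 : Real.sqrt (((X + 1) / P2 + 2) * (P2 / (2 * ((2 : ℝ) ^ (2 * ρ) - 1)))) ≤ Real.sqrt (2 * X) / 2 ^ ρ := by
    calc Real.sqrt (((X + 1) / P2 + 2) * (P2 / (2 * ((2 : ℝ) ^ (2 * ρ) - 1)))) ≤ Real.sqrt (2 * X / 2 ^ (2 * ρ)) :=
          Real.sqrt_le_sqrt h2
      _ = Real.sqrt (2 * X) / 2 ^ ρ := by
          rw [Real.sqrt_div' _ (by positivity), show (2 : ℝ) ^ (2 * ρ) = (2 ^ ρ) ^ 2 by rw [← pow_mul]; ring_nf,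
            Real.sqrt_sq (by positivity)]
  -- combine
  have hXX : Real.sqrt X * Real.sqrt (2 * X) = Real.sqrt 2 * X := by
    rw [← Real.sqrt_mul hX0.le, show X * (2 * X) = 2 * X ^ 2 by ring, Real.sqrt_mul (by norm_num),
      Real.sqrt_sq hX0.le]
  have hs2 : Real.sqrt 2 ≤ 23 / 16 := by
    rw [Real.sqrt_le_left (by norm_num)]; norm_num
  have hXMN : X = 8 * 2 ^ i * 2 ^ j := by rw [hX, pow_add, pow_add]; ring
  calc 4 * Real.sqrt (X * (1 + Real.log X) ^ 3) * Real.sqrt (((X + 1) / P2 + 2) * (P2 / (2 * ((2 : ℝ) ^ (2 * ρ) - 1))))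
      ≤ 4 * (Real.sqrt X * (D ^ 2 / 2)) * (Real.sqrt (2 * X) / 2 ^ ρ) :=
        mul_le_mul (mul_le_mul_of_nonneg_left h1 (by norm_num)) h3 (Real.sqrt_nonneg _) (by positivity)
    _ = 2 * D ^ 2 * (Real.sqrt X * Real.sqrt (2 * X)) / 2 ^ ρ := by ring
    _ = 2 * D ^ 2 * (Real.sqrt 2 * X) / 2 ^ ρ := by rw [hXX]
    _ ≤ 2 * D ^ 2 * ((23 / 16) * X) / 2 ^ ρ := by
        refine div_le_div_of_nonneg_right (mul_le_mul_of_nonneg_left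
          (mul_le_mul_of_nonneg_right hs2 hX0.le) (by positivity)) (by positivity)
    _ = 23 * D ^ 2 * 2 ^ i * 2 ^ j / 2 ^ ρ := by rw [hXMN]; ring

/-! ### The bookkeeping inequality and the main theorem -/

/-- The bookkeeping behind `boxSum_sq_typeII_high_bound`: with `u = 1/L ≤ v = 1/T`, `D ≥ 4`,
`ERR ≤ 12MNv`, `SUB ≤ 23D²MNu`, `0 ≤ F ≤ 2^{17}D³(u + Q)`:
`M(4N/L)(MN + L(2ERR + SUB + MNF)) ≤ (MN)² 2^{20} D³ (v + Q)`. [folklore] -/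
theorem high_bound_algebra {M N L v D ERR SUB F Q : ℝ} (hM : 0 < M) (hN : 0 < N) (hL : 0 < L)
    (hv : 1 / L ≤ v) (hD : 4 ≤ D) (hQ : 0 ≤ Q) (hERR0 : 0 ≤ ERR) (hERR : ERR ≤ 12 * (M * N) * v)
    (hSUB0 : 0 ≤ SUB) (hSUB : SUB ≤ 23 * D ^ 2 * (M * N) * (1 / L)) (hF0 : 0 ≤ F)
    (hF : F ≤ 2 ^ 17 * D ^ 3 * (1 / L + Q)) :
    M * (4 * N / L) * (M * N + L * (2 * ERR + SUB + M * N * F)) ≤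
      (M * N) ^ 2 * (2 ^ 20 * D ^ 3 * (v + Q)) := by
  set u : ℝ := 1 / L with hu
  have hu0 : 0 < u := by rw [hu]; positivity
  have hv0 : 0 < v := lt_of_lt_of_le hu0 hv
  have hD0 : 0 < D := by linarith only [hD]
  have hMN : 0 < M * N := mul_pos hM hN
  have e1 : M * (4 * N / L) * (M * N + L * (2 * ERR + SUB + M * N * F)) =
      4 * (M * N) ^ 2 * u + 4 * (M * N) * (2 * ERR + SUB + M * N * F) := by
    rw [hu]; field_simp
  rw [e1]
  have h1 : 2 * ERR + SUB + M * N * F ≤ (M * N) * (24 * v + 23 * D ^ 2 * u + 2 ^ 17 * D ^ 3 * (u + Q)) := by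
    have := mul_le_mul_of_nonneg_left hF hMN.le
    nlinarith only [hERR, hSUB, this]
  have h2 : u + (24 * v + 23 * D ^ 2 * u + 2 ^ 17 * D ^ 3 * (u + Q)) ≤ 2 ^ 18 * D ^ 3 * (v + Q) := by
    have h3 : 25 + 23 * D ^ 2 ≤ 2 ^ 17 * D ^ 3 := by nlinarith only [hD]
    have h4 : (25 + 23 * D ^ 2) * u ≤ (25 + 23 * D ^ 2) * v := mul_le_mul_of_nonneg_left hv (by positivity)
    have h5 : (25 + 23 * D ^ 2) * v ≤ 2 ^ 17 * D ^ 3 * v := mul_le_mul_of_nonneg_right h3 hv0.le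
    have h6 : D ^ 3 * u ≤ D ^ 3 * v := mul_le_mul_of_nonneg_left hv (by positivity)
    have h7 : 23 * D ^ 2 * u ≤ 23 * D ^ 2 * v := mul_le_mul_of_nonneg_left hv (by positivity)
    have h8 : 0 ≤ D ^ 3 * Q := by positivity
    linarith only [hv, h5, h6, h7, h8]
  calc 4 * (M * N) ^ 2 * u + 4 * (M * N) * (2 * ERR + SUB + M * N * F)
      ≤ 4 * (M * N) ^ 2 * u + 4 * (M * N) * ((M * N) * (24 * v + 23 * D ^ 2 * u + 2 ^ 17 * D ^ 3 * (u + Q))) := by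
        have := mul_le_mul_of_nonneg_left h1 (by positivity : 0 ≤ 4 * (M * N))
        linarith only [this]
    _ = 4 * (M * N) ^ 2 * (u + (24 * v + 23 * D ^ 2 * u + 2 ^ 17 * D ^ 3 * (u + Q))) := by ring
    _ ≤ 4 * (M * N) ^ 2 * (2 ^ 18 * D ^ 3 * (v + Q)) := mul_le_mul_of_nonneg_left h2 (by positivity)
    _ = (M * N) ^ 2 * (2 ^ 20 * D ^ 3 * (v + Q)) := by ring

set_option maxHeartbeats 1000000 in
/-- **Type-II box estimate, shifted window, closed form** (Bourgain 2013, §2 (2.23)–(2.29)). For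
a digit set `T`, a box `D_i × D_j` and a window `[K, K + σ)`, `σ = i + ρ + 1 + t`, with
`1 ≤ ρ`, `t ≤ ρ`, `60ρ ≤ i ≤ j`, `170ρ ≤ j`, `2ρ + 2 ≤ K`, `9i + 80ρ ≤ 10K`, `K + 3ρ ≤ j`, and
`|α|, |β| ≤ 1`:
`(boxSum T i j α β)² ≤ 4^{i+j} · 2^{20} (i+j+ρ+t+4)³ (1/2^t + 2^{165ρ} η²)`,
`η = 2·2^{-c₂ |T ∩ [K, K+σ)|}` — the printed (2.29) "`(2.1) < X(L^{-cε} + L²M^{-c} + L^C 2^{-c|S'|})`"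
for the shifted windows (`L = 2^ρ`, `2^{-t} = L^{-ε}`), all losses `L^{O(1)}`, `λ^{O(1)}` explicit.
[cite: Bourgain2013MoebiusWalsh, §2 (2.29)] -/
theorem boxSum_sq_typeII_high_bound (T : Finset ℕ) {i j ρ K t : ℕ} (hρ : 1 ≤ ρ) (htρ : t ≤ ρ)
    (hi : 60 * ρ ≤ i) (hij : i ≤ j) (hj : 170 * ρ ≤ j) (hKlo : 2 * ρ + 2 ≤ K)
    (hK : 9 * i + 80 * ρ ≤ 10 * K) (hKhi : K + 3 * ρ ≤ j)
    (α β : ℕ → ℝ) (hα : ∀ a, |α a| ≤ 1) (hβ : ∀ b, |β b| ≤ 1) :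
    (boxSum T i j α β) ^ 2 ≤
      4 ^ (i + j) * (2 ^ 20 * ((i : ℝ) + j + ρ + t + 4) ^ 3 *
        (1 / 2 ^ t + 2 ^ (165 * ρ) *
          (2 * (2 : ℝ) ^ (-(walshSupExponent *
            ((T.filter (fun x => K ≤ x ∧ x < K + (i + ρ + 1 + t))).card : ℝ)))) ^ 2)) := by
  have hρKj : ρ + K ≤ j := by omega
  have hKj : K ≤ j := by omega
  have hK₁ : 2 ≤ 2 ^ (2 * ρ) := by
    calc 2 = 2 ^ 1 := by norm_num
      _ ≤ 2 ^ (2 * ρ) := Nat.pow_le_pow_right (by norm_num) (by omega)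
  have hKq : 4 * 2 ^ (2 * ρ) ≤ 2 ^ K := by
    calc 4 * 2 ^ (2 * ρ) = 2 ^ (2 * ρ + 2) := by rw [pow_add]; ring
      _ ≤ 2 ^ K := Nat.pow_le_pow_right (by norm_num) hKlo
  have hy : (1 : ℝ) ≤ (2 : ℝ) ^ (160 * ρ) := one_le_pow₀ one_le_two
  have hmain := boxSum_sq_typeII_high_le T (i := i) (j := j) (ρ := ρ) (K := K) (t := t) (K₁ := 2 ^ (2 * ρ))
    hρKj hK₁ hKq α β hα hβ hy
  -- the digit count of the truncated set
  set s : ℕ := (T.filter (fun x => K ≤ x ∧ x < K + (i + ρ + 1 + t))).card with hs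
  have hcard : ((T.filter fun x => K ≤ x ∧ x < K + (i + ρ + 1 + t)).attachFin
      (mem_filter_window_high T K (K + (i + ρ + 1 + t))).1).card = s := Finset.card_attachFin _ _
  rw [hcard] at hmain
  -- names
  set D : ℝ := (i : ℝ) + j + ρ + t + 4 with hD
  set e : ℝ := (2 * (2 : ℝ) ^ (-(walshSupExponent * (s : ℝ)))) ^ 2 with he
  set M : ℝ := (2 : ℝ) ^ i with hM
  set N : ℝ := (2 : ℝ) ^ j with hN
  set L : ℝ := (2 : ℝ) ^ ρ with hL
  set ERR : ℝ := M * ((N / 2 ^ (ρ + K + t) + 2) * (2 ^ (ρ + K + 1) + 1)) with hERR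
  set SUB : ℝ := 4 * Real.sqrt (((2 ^ (i + j + 3) : ℕ) : ℝ) * (1 + Real.log ((2 ^ (i + j + 3) : ℕ) : ℝ)) ^ 3) *
      Real.sqrt (((((2 ^ (i + j + 3) + 1 : ℕ)) : ℝ) / 2 ^ (K + (i + ρ + 1 + t)) + 2) *
        (2 ^ (K + (i + ρ + 1 + t)) / (2 * ((((2 ^ (2 * ρ) : ℕ)) : ℝ) - 1)))) with hSUB
  set F : ℝ := highPairFactor s K (2 ^ (2 * ρ)) (i + ρ + 1 + t) (2 ^ i) (2 ^ j) (2 ^ ρ)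
      ((2 : ℝ) ^ (160 * ρ)) ((2 : ℝ) ^ (ρ + 1 + t)) with hF
  have hM0 : 0 < M := by rw [hM]; positivity
  have hN0 : 0 < N := by rw [hN]; positivity
  have hL0 : 0 < L := by rw [hL]; positivity
  have he0 : 0 ≤ e := by rw [he]; positivity
  have hD4 : 4 ≤ D := by
    rw [hD]; have : (0:ℝ) ≤ i := Nat.cast_nonneg i; have : (0:ℝ) ≤ j := Nat.cast_nonneg j
    have : (0:ℝ) ≤ ρ := Nat.cast_nonneg ρ; have : (0:ℝ) ≤ t := Nat.cast_nonneg t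
    linarith
  -- the four inputs of the bookkeeping lemma
  have hF0 : 0 ≤ F := by rw [hF]; exact highPairFactor_nonneg _ _ _ _ _ _ _ (by positivity) (by positivity)
  have hFle : F ≤ 2 ^ 17 * D ^ 3 * (1 / L + 2 ^ (165 * ρ) * e) := by
    rw [hF, hD, hL, he]; exact highPairFactor_le s K i j ρ t hρ htρ hi hij hj hKj hK
  have hERR0 : 0 ≤ ERR := by rw [hERR]; positivity
  have hERRle : ERR ≤ 12 * (M * N) * (1 / 2 ^ t) := by
    rw [hERR]
    have h := carry_factor_le (j := j) hρ htρ hKhi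
    rw [← hN] at h
    calc M * ((N / 2 ^ (ρ + K + t) + 2) * (2 ^ (ρ + K + 1) + 1)) ≤ M * (12 * N / 2 ^ t) :=
          mul_le_mul_of_nonneg_left h hM0.le
      _ = 12 * (M * N) * (1 / 2 ^ t) := by ring
  have hSUB0 : 0 ≤ SUB := by rw [hSUB]; positivity
  have hSUBle : SUB ≤ 23 * D ^ 2 * (M * N) * (1 / L) := by
    rw [hSUB, hD, hM, hN, hL]
    refine (subst_error_le (i := i) (j := j) hρ htρ hKhi).trans (le_of_eq ?_)
    ring
  have hv : 1 / L ≤ 1 / (2 : ℝ) ^ t := by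
    rw [hL]; exact one_div_le_one_div_of_le (by positivity) (pow_le_pow_right₀ one_le_two htρ)
  have halg := high_bound_algebra (Q := 2 ^ (165 * ρ) * e) hM0 hN0 hL0 hv hD4 (by positivity) hERR0 hERRle
    hSUB0 hSUBle hF0 hFle
  -- the prefactor
  have hfac : 2 * ((2 : ℝ) ^ j + 2 ^ ρ * 2 ^ K) / 2 ^ ρ ≤ 4 * N / L := by
    rw [hN, hL]
    refine div_le_div_of_nonneg_right ?_ (by positivity)
    have : (2 : ℝ) ^ ρ * 2 ^ K ≤ 2 ^ j := by rw [← pow_add]; exact pow_le_pow_right₀ one_le_two hρKj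
    linarith only [this]
  have hbr0 : 0 ≤ M * N + L * (2 * ERR + SUB + M * N * F) := by positivity
  have hMN2 : (M * N) ^ 2 = (4 : ℝ) ^ (i + j) := by
    rw [hM, hN, ← pow_add, ← pow_mul, show (4 : ℝ) = 2 ^ 2 by norm_num, ← pow_mul, mul_comm]
  calc (boxSum T i j α β) ^ 2
      ≤ 2 ^ i * (2 * ((2 : ℝ) ^ j + 2 ^ ρ * 2 ^ K) / 2 ^ ρ) * (M * N + L * (2 * ERR + SUB + M * N * F)) := by
        rw [hM, hN, hL, hERR, hSUB, hF]; exact hmain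
    _ ≤ M * (4 * N / L) * (M * N + L * (2 * ERR + SUB + M * N * F)) := by
        rw [← hM]
        exact mul_le_mul_of_nonneg_right (mul_le_mul_of_nonneg_left hfac hM0.le) hbr0
    _ ≤ (M * N) ^ 2 * (2 ^ 20 * D ^ 3 * (1 / 2 ^ t + 2 ^ (165 * ρ) * e)) := halg
    _ = _ := by rw [hMN2, hD, he]

/-- **Type-II box estimate, shifted window** — the square root of `boxSum_sq_typeII_high_bound`
against any majorant `X² ≥` its right-hand side. [cite: Bourgain2013MoebiusWalsh, §2 (2.29)] -/
theorem abs_boxSum_typeII_high_bound (T : Finset ℕ) {i j ρ K t : ℕ} (hρ : 1 ≤ ρ) (htρ : t ≤ ρ)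
    (hi : 60 * ρ ≤ i) (hij : i ≤ j) (hj : 170 * ρ ≤ j) (hKlo : 2 * ρ + 2 ≤ K)
    (hK : 9 * i + 80 * ρ ≤ 10 * K) (hKhi : K + 3 * ρ ≤ j)
    (α β : ℕ → ℝ) (hα : ∀ a, |α a| ≤ 1) (hβ : ∀ b, |β b| ≤ 1) {X : ℝ}
    (hX : 4 ^ (i + j) * (2 ^ 20 * ((i : ℝ) + j + ρ + t + 4) ^ 3 *
        (1 / 2 ^ t + 2 ^ (165 * ρ) *
          (2 * (2 : ℝ) ^ (-(walshSupExponent *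
            ((T.filter (fun x => K ≤ x ∧ x < K + (i + ρ + 1 + t))).card : ℝ)))) ^ 2)) ≤ X ^ 2)
    (hX0 : 0 ≤ X) :
    |boxSum T i j α β| ≤ X :=
  abs_le_of_sq_le_sq ((boxSum_sq_typeII_high_bound T hρ htρ hi hij hj hKlo hK hKhi α β hα hβ).trans hX) hX0



open Literature.NumberTheory.LFunctions.MoebiusWalshVaughan (natWalsh dyBlock mem_dyBlock boxSum
  abs_natWalsh abs_natWalsh_le)
open Literature.NumberTheory.LFunctions.MoebiusWalsh (walshSupExponent walshSupExponent_pos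
  walshL1Exponent)

/-! ### The sign trick and the trivial bound -/

/-- `∑_a |∑_b β(b) w_T(ab)| = boxSum T i j α β` with the signs `α(a) = sgn ∑_b β(b) w_T(ab)`.
[folklore] -/
theorem perBox_sum_abs_eq_boxSum (T : Finset ℕ) (i j : ℕ) (β : ℕ → ℝ) :
    ∑ a ∈ dyBlock i, |∑ b ∈ dyBlock j, β b * natWalsh T (a * b)| =
      boxSum T i j (fun a => if 0 ≤ ∑ b ∈ dyBlock j, β b * natWalsh T (a * b) then 1 else -1) β := by
  unfold boxSum
  refine Finset.sum_congr rfl fun a _ => ?_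
  have e : ∑ b ∈ dyBlock j, (if 0 ≤ ∑ b ∈ dyBlock j, β b * natWalsh T (a * b) then (1 : ℝ) else -1) * β b *
      natWalsh T (a * b) = (if 0 ≤ ∑ b ∈ dyBlock j, β b * natWalsh T (a * b) then (1 : ℝ) else -1) *
        ∑ b ∈ dyBlock j, β b * natWalsh T (a * b) := by
    rw [Finset.mul_sum]; exact Finset.sum_congr rfl fun b _ => by ring
  rw [e]
  split_ifs with h
  · rw [one_mul, abs_of_nonneg h]
  · rw [abs_of_neg (not_le.mp h)]; ring

/-- The signs have modulus `≤ 1`. [folklore] -/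
theorem abs_sign_le_one (T : Finset ℕ) (j : ℕ) (β : ℕ → ℝ) (a : ℕ) :
    |(if 0 ≤ ∑ b ∈ dyBlock j, β b * natWalsh T (a * b) then (1 : ℝ) else -1)| ≤ 1 := by
  split_ifs <;> simp

/-- The trivial bound `∑_{a ∈ D_i} |∑_{b ∈ D_j} β(b) w_T(ab)| ≤ 2^i 2^j` (`|β| ≤ 1`). [folklore] -/
theorem sum_abs_le_trivial (T : Finset ℕ) (i j : ℕ) {β : ℕ → ℝ} (hβ : ∀ b, |β b| ≤ 1) :
    ∑ a ∈ dyBlock i, |∑ b ∈ dyBlock j, β b * natWalsh T (a * b)| ≤ (2 : ℝ) ^ i * 2 ^ j := by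
  have hb : ∀ a, |∑ b ∈ dyBlock j, β b * natWalsh T (a * b)| ≤ (2 : ℝ) ^ j := by
    intro a
    refine (Finset.abs_sum_le_sum_abs _ _).trans ?_
    calc ∑ b ∈ dyBlock j, |β b * natWalsh T (a * b)| ≤ ∑ _b ∈ dyBlock j, (1 : ℝ) := by
          refine Finset.sum_le_sum fun b _ => ?_
          rw [abs_mul, abs_natWalsh, mul_one]; exact hβ b
      _ = 2 ^ j := by rw [Finset.sum_const, card_dyBlock, nsmul_eq_mul, mul_one]; push_cast; ring
  calc ∑ a ∈ dyBlock i, |∑ b ∈ dyBlock j, β b * natWalsh T (a * b)| ≤ ∑ _a ∈ dyBlock i, (2 : ℝ) ^ j :=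
        Finset.sum_le_sum fun a _ => hb a
    _ = 2 ^ i * 2 ^ j := by rw [Finset.sum_const, card_dyBlock, nsmul_eq_mul]; push_cast; ring

/-- From a squared box bound to the bound itself: `X ≥ 0`, `X² ≤ 4^{i+j} Φ` give `X ≤ 2^i 2^j √Φ`.
[folklore] -/
theorem le_of_sq_le_four_pow {X Φ : ℝ} (hX : 0 ≤ X) {i j : ℕ} (h : X ^ 2 ≤ 4 ^ (i + j) * Φ) :
    X ≤ (2 : ℝ) ^ i * 2 ^ j * Real.sqrt Φ := by
  have hΦ : 0 ≤ 4 ^ (i + j) * Φ := le_trans (sq_nonneg X) h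
  have hΦ0 : 0 ≤ Φ := nonneg_of_mul_nonneg_right (by rwa [mul_comm] at hΦ) (by positivity)
  have h4 : (4 : ℝ) ^ (i + j) = ((2 : ℝ) ^ i * 2 ^ j) ^ 2 := by
    rw [← pow_add, ← pow_mul, show (4 : ℝ) = 2 ^ 2 by norm_num, ← pow_mul, mul_comm]
  calc X = Real.sqrt (X ^ 2) := (Real.sqrt_sq hX).symm
    _ ≤ Real.sqrt (4 ^ (i + j) * Φ) := Real.sqrt_le_sqrt h
    _ = (2 : ℝ) ^ i * 2 ^ j * Real.sqrt Φ := by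
        rw [h4, Real.sqrt_mul (sq_nonneg _), Real.sqrt_sq (by positivity)]

/-- `√(a + b) ≤ √a + √b` for `a, b ≥ 0`. [folklore] -/
theorem perBox_sqrt_add_le {a b : ℝ} (ha : 0 ≤ a) (hb : 0 ≤ b) : Real.sqrt (a + b) ≤ Real.sqrt a + Real.sqrt b :=
  Literature.NumberTheory.LFunctions.MoebiusWalsh.sqrt_add_le_sqrt_add ha hb

/-- `√(2^x) = 2^{x/2}` (`rpow`). [folklore] -/
theorem sqrt_two_rpow (x : ℝ) : Real.sqrt ((2 : ℝ) ^ x) = (2 : ℝ) ^ (x / 2) := by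
  rw [Real.sqrt_eq_rpow, ← Real.rpow_mul (by norm_num)]; ring_nf

/-- `√(c · 2^x) = √c · 2^{x/2}`. [folklore] -/
theorem sqrt_mul_two_rpow {c : ℝ} (hc : 0 ≤ c) (x : ℝ) :
    Real.sqrt (c * (2 : ℝ) ^ x) = Real.sqrt c * (2 : ℝ) ^ (x / 2) := by
  rw [Real.sqrt_mul hc, sqrt_two_rpow]

/-! ### The two closed forms, after the square root -/

/-- `1/2^{⌊ρ/2⌋} ≤ 2^{-(ρ-1)/2}`. [folklore] -/
theorem inv_two_pow_half_le (ρ : ℕ) : 1 / (2 : ℝ) ^ (ρ / 2) ≤ (2 : ℝ) ^ (-(((ρ : ℝ) - 1) / 2)) := by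
  rw [one_div, two_pow_eq_rpow, ← Real.rpow_neg (by norm_num)]
  refine two_rpow_le_two_rpow ?_
  have h : ((ρ / 2 : ℕ) : ℝ) ≥ ((ρ : ℝ) - 1) / 2 := by
    have h1 : 2 * (ρ / 2) + ρ % 2 = ρ := Nat.div_add_mod ρ 2
    have h2 : ρ % 2 ≤ 1 := Nat.lt_succ_iff.mp (Nat.mod_lt ρ two_pos)
    have h3 : ((2 * (ρ / 2) + ρ % 2 : ℕ) : ℝ) = ρ := by exact_mod_cast h1
    push_cast at h3
    have h4 : ((ρ % 2 : ℕ) : ℝ) ≤ 1 := by exact_mod_cast h2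
    linarith
  linarith

/-- The `K = 0` closed form after the square root: for `1 ≤ ρ₀`, `50ρ₀ ≤ j`, `e ≥ 0`,
`√(324/2^{⌊ρ₀/2⌋} + 24/2^{ρ₀} + 48·2^{ρ₀}/2^j + 32·2^{57ρ₀} e) ≤ 24·2^{-ρ₀/4} + 6·2^{(57/2)ρ₀} √e`.
[cite: Bourgain2013MoebiusWalsh, (2.22)] -/
theorem zero_case_sqrt_le {j ρ₀ : ℕ} (hρ₀ : 1 ≤ ρ₀) (hj : 50 * ρ₀ ≤ j) {e : ℝ} (he : 0 ≤ e) :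
    Real.sqrt (324 / 2 ^ (ρ₀ / 2) + 24 / 2 ^ ρ₀ + 48 * 2 ^ ρ₀ / 2 ^ j + 32 * 2 ^ (54 * ρ₀ + 3 * ρ₀) * e) ≤
      24 * (2 : ℝ) ^ (-((ρ₀ : ℝ) / 4)) + 6 * (2 : ℝ) ^ ((57 / 2) * (ρ₀ : ℝ)) * Real.sqrt e := by
  set w : ℝ := (2 : ℝ) ^ (-(((ρ₀ : ℝ) - 1) / 2)) with hw
  have hw0 : 0 ≤ w := by rw [hw]; positivity
  have hρr : (1 : ℝ) ≤ ρ₀ := by exact_mod_cast hρ₀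
  have h1 : 324 / (2 : ℝ) ^ (ρ₀ / 2) ≤ 324 * w := by
    rw [div_eq_mul_one_div]; exact mul_le_mul_of_nonneg_left (inv_two_pow_half_le ρ₀) (by norm_num)
  have h2 : 24 / (2 : ℝ) ^ ρ₀ ≤ 24 * w := by
    rw [div_eq_mul_one_div]
    refine mul_le_mul_of_nonneg_left ?_ (by norm_num)
    rw [one_div, two_pow_eq_rpow, ← Real.rpow_neg (by norm_num), hw]
    exact two_rpow_le_two_rpow (by linarith)
  have h3 : 48 * (2 : ℝ) ^ ρ₀ / 2 ^ j ≤ 48 * w := by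
    rw [mul_div_assoc]
    refine mul_le_mul_of_nonneg_left ?_ (by norm_num)
    rw [two_pow_eq_rpow, two_pow_eq_rpow, ← Real.rpow_sub two_pos, hw]
    have : (50 : ℝ) * ρ₀ ≤ j := by exact_mod_cast hj
    exact two_rpow_le_two_rpow (by linarith)
  have hfirst : 324 / (2 : ℝ) ^ (ρ₀ / 2) + 24 / 2 ^ ρ₀ + 48 * 2 ^ ρ₀ / 2 ^ j ≤ 396 * w := by linarith
  have hsq396 : Real.sqrt (396 * w) ≤ 24 * (2 : ℝ) ^ (-((ρ₀ : ℝ) / 4)) := by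
    have e1 : Real.sqrt (396 * w) = Real.sqrt 396 * (2 : ℝ) ^ (-(((ρ₀ : ℝ) - 1) / 2) / 2) := by
      rw [hw]; exact sqrt_mul_two_rpow (by norm_num) _
    have e2 : (2 : ℝ) ^ (-(((ρ₀ : ℝ) - 1) / 2) / 2) = (2 : ℝ) ^ ((1 : ℝ) / 4) * (2 : ℝ) ^ (-((ρ₀ : ℝ) / 4)) := by
      rw [two_rpow_mul_two_rpow]; ring_nf
    have h396 : Real.sqrt 396 ≤ 20 := by rw [Real.sqrt_le_left (by norm_num)]; norm_num
    have h14 : (2 : ℝ) ^ ((1 : ℝ) / 4) ≤ 6 / 5 := by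
      have h : ((6 : ℝ) / 5) ^ (4 : ℕ) = 1296 / 625 := by norm_num
      have h' : (2 : ℝ) ≤ ((6 : ℝ) / 5) ^ ((4 : ℕ) : ℝ) := by rw [Real.rpow_natCast, h]; norm_num
      calc (2 : ℝ) ^ ((1 : ℝ) / 4) ≤ ((((6 : ℝ) / 5) ^ ((4 : ℕ) : ℝ))) ^ ((1 : ℝ) / 4) :=
            Real.rpow_le_rpow (by norm_num) h' (by norm_num)
        _ = 6 / 5 := by rw [← Real.rpow_mul (by norm_num)]; norm_num
    rw [e1, e2]
    have h0 : 0 ≤ (2 : ℝ) ^ (-((ρ₀ : ℝ) / 4)) := by positivity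
    calc Real.sqrt 396 * ((2 : ℝ) ^ ((1 : ℝ) / 4) * (2 : ℝ) ^ (-((ρ₀ : ℝ) / 4)))
        = (Real.sqrt 396 * (2 : ℝ) ^ ((1 : ℝ) / 4)) * (2 : ℝ) ^ (-((ρ₀ : ℝ) / 4)) := by ring
      _ ≤ (20 * (6 / 5)) * (2 : ℝ) ^ (-((ρ₀ : ℝ) / 4)) := by
          refine mul_le_mul_of_nonneg_right (mul_le_mul h396 h14 (by positivity) (by norm_num)) h0
      _ = 24 * (2 : ℝ) ^ (-((ρ₀ : ℝ) / 4)) := by norm_num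
  have hsecond : Real.sqrt (32 * 2 ^ (54 * ρ₀ + 3 * ρ₀) * e) ≤ 6 * (2 : ℝ) ^ ((57 / 2) * (ρ₀ : ℝ)) * Real.sqrt e := by
    have e1 : (32 : ℝ) * 2 ^ (54 * ρ₀ + 3 * ρ₀) * e = 32 * ((2 : ℝ) ^ ((57 : ℝ) * ρ₀) * e) := by
      rw [two_pow_eq_rpow]; push_cast; ring_nf
    rw [e1, Real.sqrt_mul (by norm_num), Real.sqrt_mul (by positivity), sqrt_two_rpow]
    have h32 : Real.sqrt 32 ≤ 6 := by rw [Real.sqrt_le_left (by norm_num)]; norm_num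
    have e2 : (57 : ℝ) * ρ₀ / 2 = 57 / 2 * (ρ₀ : ℝ) := by ring
    rw [e2]
    have h0 : 0 ≤ (2 : ℝ) ^ (57 / 2 * (ρ₀ : ℝ)) * Real.sqrt e := by positivity
    calc Real.sqrt 32 * ((2 : ℝ) ^ (57 / 2 * (ρ₀ : ℝ)) * Real.sqrt e) ≤ 6 * ((2 : ℝ) ^ (57 / 2 * (ρ₀ : ℝ)) * Real.sqrt e) :=
          mul_le_mul_of_nonneg_right h32 h0
      _ = _ := by ring
  calc Real.sqrt (324 / 2 ^ (ρ₀ / 2) + 24 / 2 ^ ρ₀ + 48 * 2 ^ ρ₀ / 2 ^ j + 32 * 2 ^ (54 * ρ₀ + 3 * ρ₀) * e)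
      ≤ Real.sqrt (396 * w + 32 * 2 ^ (54 * ρ₀ + 3 * ρ₀) * e) := Real.sqrt_le_sqrt (by linarith)
    _ ≤ Real.sqrt (396 * w) + Real.sqrt (32 * 2 ^ (54 * ρ₀ + 3 * ρ₀) * e) := perBox_sqrt_add_le (by positivity) (by positivity)
    _ ≤ _ := add_le_add hsq396 hsecond

/-- The shifted-window closed form after the square root: for `2ρ₀ ≤ i + j`, `e ≥ 0`,
`√(2^{20}(i+j+2ρ₀+4)³(1/2^{ρ₀} + 2^{165ρ₀} e)) ≤ 2^{12}(i+j+2)²(2^{-ρ₀/2} + 2^{(165/2)ρ₀}√e)`.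
[cite: Bourgain2013MoebiusWalsh, (2.28)] -/
theorem high_case_sqrt_le {i j ρ₀ : ℕ} (h : 2 * ρ₀ ≤ i + j) {e : ℝ} (he : 0 ≤ e) :
    Real.sqrt (2 ^ 20 * ((i : ℝ) + j + ρ₀ + ρ₀ + 4) ^ 3 * (1 / 2 ^ ρ₀ + 2 ^ (165 * ρ₀) * e)) ≤
      2 ^ 12 * ((i : ℝ) + j + 2) ^ 2 * ((2 : ℝ) ^ (-((ρ₀ : ℝ) / 2)) + (2 : ℝ) ^ ((165 / 2) * (ρ₀ : ℝ)) * Real.sqrt e) := by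
  set P : ℝ := (i : ℝ) + j + 2 with hP
  have hP2 : 2 ≤ P := by rw [hP]; have : (0:ℝ) ≤ i := Nat.cast_nonneg i; have : (0:ℝ) ≤ j := Nat.cast_nonneg j; linarith
  have hhr : 2 * (ρ₀ : ℝ) ≤ i + j := by exact_mod_cast h
  have hY : (i : ℝ) + j + ρ₀ + ρ₀ + 4 ≤ 2 * P := by rw [hP]; linarith
  have hY0 : 0 ≤ (i : ℝ) + j + ρ₀ + ρ₀ + 4 := by positivity
  have hcube : ((i : ℝ) + j + ρ₀ + ρ₀ + 4) ^ 3 ≤ (4 * P ^ 2) ^ 2 := by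
    calc ((i : ℝ) + j + ρ₀ + ρ₀ + 4) ^ 3 ≤ (2 * P) ^ 3 := pow_le_pow_left₀ hY0 hY 3
      _ ≤ (2 * P) ^ 4 := pow_le_pow_right₀ (by linarith) (by norm_num)
      _ = (4 * P ^ 2) ^ 2 := by ring
  have hZ : Real.sqrt (1 / 2 ^ ρ₀ + 2 ^ (165 * ρ₀) * e) ≤
      (2 : ℝ) ^ (-((ρ₀ : ℝ) / 2)) + (2 : ℝ) ^ ((165 / 2) * (ρ₀ : ℝ)) * Real.sqrt e := by
    refine (perBox_sqrt_add_le (by positivity) (by positivity)).trans (add_le_add (le_of_eq ?_) (le_of_eq ?_))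
    · rw [one_div, two_pow_eq_rpow, ← Real.rpow_neg (by norm_num), sqrt_two_rpow]; ring_nf
    · rw [two_pow_eq_rpow, Real.sqrt_mul (by positivity), sqrt_two_rpow]; push_cast; ring_nf
  calc Real.sqrt (2 ^ 20 * ((i : ℝ) + j + ρ₀ + ρ₀ + 4) ^ 3 * (1 / 2 ^ ρ₀ + 2 ^ (165 * ρ₀) * e))
      ≤ Real.sqrt ((2 ^ 10 * (4 * P ^ 2)) ^ 2 * (1 / 2 ^ ρ₀ + 2 ^ (165 * ρ₀) * e)) := by
        refine Real.sqrt_le_sqrt (mul_le_mul_of_nonneg_right ?_ (by positivity))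
        rw [mul_pow]; exact mul_le_mul (by norm_num) hcube (by positivity) (by positivity)
    _ = 2 ^ 10 * (4 * P ^ 2) * Real.sqrt (1 / 2 ^ ρ₀ + 2 ^ (165 * ρ₀) * e) := by
        rw [Real.sqrt_mul (sq_nonneg _), Real.sqrt_sq (by positivity)]
    _ ≤ 2 ^ 10 * (4 * P ^ 2) * ((2 : ℝ) ^ (-((ρ₀ : ℝ) / 2)) + (2 : ℝ) ^ ((165 / 2) * (ρ₀ : ℝ)) * Real.sqrt e) :=
        mul_le_mul_of_nonneg_left hZ (by positivity)
    _ = _ := by ring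

/-! ### The per-box type-II estimate -/

set_option maxHeartbeats 2000000 in
/-- **The per-box type-II estimate of Bourgain 2013, §2 ((2.29)/(2.31)), both windows.** With
`c = 1/800`, `C = 16`: for every digit set `T`, box `D_i × D_j` with `i ≤ j`, `ρ ≥ 1`, admissible
shift `K` (`K = 0`, or `i ≤ K + ρ` and `4ρ < K`) with `K + ρ ≤ j`, and coefficients `|β| ≤ 1`,
`∑_{a ∈ D_i} |∑_{b ∈ D_j} β(b) w_T(ab)| ≤ (i+j+2)^C 2^{i+j} (2^{-cρ} + 2^{Cρ - ci} + 2^{Cρ - c|T ∩ [K, K+i)|})`.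
This is the hypothesis `hII` of `LiouvilleWalsh.bourgain_liouville_walsh_uniform_of_typeII`, obtained
from `boxSum_sq_typeII_zero_bound` (`K = 0`) and `boxSum_sq_typeII_high_bound` (window
`[K - 2ρ₀ - 1, K + i)`) with `ρ₀ = ⌊ρ/200⌋`, `t = ρ₀`; when `ρ < 200` or `i < 12ρ` the right-hand
side dominates the trivial bound `2^{i+j}`. [cite: Bourgain2013MoebiusWalsh, §2 (2.29)–(2.31)] -/
theorem typeII_perBox : ∃ c : ℝ, 0 < c ∧ ∃ C : ℝ, 1 ≤ C ∧
    ∀ (T : Finset ℕ) (i j ρ K : ℕ) (β : ℕ → ℝ), i ≤ j → 1 ≤ ρ →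
      (K = 0 ∨ (i ≤ K + ρ ∧ 4 * ρ < K)) → K + ρ ≤ j → (∀ b, |β b| ≤ 1) →
      ∑ a ∈ dyBlock i, |∑ b ∈ dyBlock j, β b * natWalsh T (a * b)| ≤
        ((i : ℝ) + j + 2) ^ C * 2 ^ (i + j) *
          ((2 : ℝ) ^ (-(c * ρ)) + (2 : ℝ) ^ (C * ρ - c * i) +
            (2 : ℝ) ^ (C * ρ - c * ((T.filter fun t => K ≤ t ∧ t < K + i).card : ℝ))) := by
  refine ⟨1 / 800, by norm_num, 16, by norm_num, ?_⟩
  intro T i j r K β hij hr hK hKj hβ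
  have hc₂ : (1 : ℝ) / 800 ≤ walshSupExponent := by
    -- `c₂ = log₂(27/16)/4 ≥ 1/800`: `27/16 ≥ 2^{1/200}`, i.e. `2 ≤ (27/16)^{200}`
    unfold walshSupExponent
    have h1 : (1 : ℝ) / 200 ≤ Real.logb 2 (27 / 16) := by
      rw [Real.le_logb_iff_rpow_le one_lt_two (by norm_num)]
      have h2 : ((2 : ℝ) ^ ((1 : ℝ) / 200)) ^ ((200 : ℕ) : ℝ) = 2 := by
        rw [← Real.rpow_mul (by norm_num)]; norm_num
      have h3 : (2 : ℝ) ≤ ((27 : ℝ) / 16) ^ ((200 : ℕ) : ℝ) := by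
        rw [Real.rpow_natCast]
        have : (3 : ℝ) / 2 ≤ ((27 : ℝ) / 16) := by norm_num
        calc (2 : ℝ) ≤ ((27 : ℝ) / 16) ^ 2 := by norm_num
          _ ≤ ((27 : ℝ) / 16) ^ 200 := pow_le_pow_right₀ (by norm_num) (by norm_num)
      by_contra hlt
      have hlt : (27 : ℝ) / 16 < (2 : ℝ) ^ ((1 : ℝ) / 200) := lt_of_not_ge hlt
      have h4 : (((27 : ℝ) / 16)) ^ ((200 : ℕ) : ℝ) < ((2 : ℝ) ^ ((1 : ℝ) / 200)) ^ ((200 : ℕ) : ℝ) :=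
        Real.rpow_lt_rpow (by norm_num) hlt (by norm_num)
      rw [h2] at h4
      linarith
    linarith
  -- the quantities
  set s : ℕ := (T.filter fun t => K ≤ t ∧ t < K + i).card with hs
  set X : ℝ := ∑ a ∈ dyBlock i, |∑ b ∈ dyBlock j, β b * natWalsh T (a * b)| with hX
  set P : ℝ := (i : ℝ) + j + 2 with hP
  have hX0 : 0 ≤ X := Finset.sum_nonneg fun a _ => abs_nonneg _
  have htriv : X ≤ (2 : ℝ) ^ i * 2 ^ j := sum_abs_le_trivial T i j hβ
  have hir : (0 : ℝ) ≤ i := Nat.cast_nonneg i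
  have hjr : (0 : ℝ) ≤ j := Nat.cast_nonneg j
  have hrr : (1 : ℝ) ≤ r := by exact_mod_cast hr
  have hsr : (0 : ℝ) ≤ s := Nat.cast_nonneg s
  have hP2 : 2 ≤ P := by rw [hP]; linarith
  have hP1 : 1 ≤ P := by linarith
  have hPC : P ^ (16 : ℝ) = P ^ (16 : ℕ) := by rw [← Real.rpow_natCast]; norm_num
  have hPpow : ∀ k : ℕ, k ≤ 16 → (2 : ℝ) ^ (16 - k) * P ^ k ≤ P ^ (16 : ℕ) := by
    intro k hk
    calc (2 : ℝ) ^ (16 - k) * P ^ k ≤ P ^ (16 - k) * P ^ k :=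
          mul_le_mul_of_nonneg_right (pow_le_pow_left₀ (by norm_num) hP2 _) (by positivity)
      _ = P ^ (16 : ℕ) := by rw [← pow_add, Nat.sub_add_cancel hk]
  have h2ij : (2 : ℝ) ^ i * 2 ^ j = 2 ^ (i + j) := (pow_add 2 i j).symm
  -- the three savings of the target, and their nonnegativity
  set E1 : ℝ := (2 : ℝ) ^ (-(1 / 800 * (r : ℝ))) with hE1
  set E2 : ℝ := (2 : ℝ) ^ (16 * (r : ℝ) - 1 / 800 * (i : ℝ)) with hE2
  set E3 : ℝ := (2 : ℝ) ^ (16 * (r : ℝ) - 1 / 800 * (s : ℝ)) with hE3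
  have hE10 : 0 ≤ E1 := by rw [hE1]; positivity
  have hE20 : 0 ≤ E2 := by rw [hE2]; positivity
  have hE30 : 0 ≤ E3 := by rw [hE3]; positivity
  show X ≤ P ^ (16 : ℝ) * 2 ^ (i + j) * (E1 + E2 + E3)
  rw [hPC]
  by_cases hdeg : r < 200 ∨ i < 12 * r
  · -- degenerate boxes: the right-hand side exceeds the trivial bound
    have hge : 1 ≤ P ^ (16 : ℕ) * (E1 + E2 + E3) := by
      rcases hdeg with h1 | h2
      · -- `P^16 E1 ≥ 2^16 2^{-1/4} ≥ 1`
        have hr200 : (r : ℝ) ≤ 200 := by exact_mod_cast h1.le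
        have hE1ge : (2 : ℝ) ^ (-(1 : ℝ)) ≤ E1 := by rw [hE1]; exact two_rpow_le_two_rpow (by linarith)
        have h216 : (2 : ℝ) ^ (16 : ℕ) ≤ P ^ (16 : ℕ) := pow_le_pow_left₀ (by norm_num) hP2 16
        have h2neg : (2 : ℝ) ^ (-(1 : ℝ)) = 1 / 2 := by rw [Real.rpow_neg (by norm_num), Real.rpow_one]; norm_num
        rw [h2neg] at hE1ge
        nlinarith [h216, hE1ge, hE20, hE30, pow_nonneg (by linarith : (0 : ℝ) ≤ P) 16]
      · -- `E2 ≥ 1`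
        have hi12 : (i : ℝ) ≤ 12 * r := by exact_mod_cast h2.le
        have hE2ge : (2 : ℝ) ^ (0 : ℝ) ≤ E2 := by rw [hE2]; exact two_rpow_le_two_rpow (by linarith)
        rw [Real.rpow_zero] at hE2ge
        have h116 : (1 : ℝ) ≤ P ^ (16 : ℕ) := one_le_pow₀ hP1
        nlinarith [h116, hE2ge, hE10, hE30]
    calc X ≤ (2 : ℝ) ^ i * 2 ^ j := htriv
      _ = 2 ^ (i + j) * 1 := by rw [h2ij, mul_one]
      _ ≤ 2 ^ (i + j) * (P ^ (16 : ℕ) * (E1 + E2 + E3)) := mul_le_mul_of_nonneg_left hge (by positivity)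
      _ = P ^ (16 : ℕ) * 2 ^ (i + j) * (E1 + E2 + E3) := by ring
  -- substantive boxes
  simp only [not_or, not_lt] at hdeg
  obtain ⟨hr200, hi12⟩ := hdeg
  set ρ₀ : ℕ := r / 200 with hρ₀
  have hρ₀1 : 1 ≤ ρ₀ := by rw [hρ₀]; exact (Nat.le_div_iff_mul_le (by norm_num)).2 (by omega)
  have hρ₀r : 200 * ρ₀ ≤ r := by rw [hρ₀]; exact Nat.mul_div_le r 200
  have hrρ₀ : r < 200 * ρ₀ + 200 := by rw [hρ₀]; have := Nat.lt_mul_div_succ r (by norm_num : 0 < 200); linarith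
  have hρ₀rr : 200 * (ρ₀ : ℝ) ≤ r := by exact_mod_cast hρ₀r
  have hrρ₀r : (r : ℝ) < 200 * ρ₀ + 200 := by exact_mod_cast hrρ₀
  have hi60 : 60 * ρ₀ ≤ i := by omega
  have hi50 : 50 * ρ₀ ≤ i := by omega
  have hj170 : 170 * ρ₀ ≤ j := by omega
  have hj50 : 50 * ρ₀ ≤ j := by omega
  have h2ρij : 2 * ρ₀ ≤ i + j := by omega
  -- the sign coefficients
  set α : ℕ → ℝ := fun a => if 0 ≤ ∑ b ∈ dyBlock j, β b * natWalsh T (a * b) then 1 else -1 with hα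
  have hαle : ∀ a, |α a| ≤ 1 := fun a => abs_sign_le_one T j β a
  have hXbox : X = boxSum T i j α β := perBox_sum_abs_eq_boxSum T i j β
  -- savings in terms of `r` and `s`
  have hsave1 : (2 : ℝ) ^ (-((ρ₀ : ℝ) / 4)) ≤ (2 : ℝ) ^ ((1 : ℝ) / 4) * E1 := by
    rw [hE1, two_rpow_mul_two_rpow]; exact two_rpow_le_two_rpow (by linarith)
  have hsave2 : (2 : ℝ) ^ (-((ρ₀ : ℝ) / 2)) ≤ (2 : ℝ) ^ ((1 : ℝ) / 2) * E1 := by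
    rw [hE1, two_rpow_mul_two_rpow]; exact two_rpow_le_two_rpow (by linarith)
  have hsqrt_e : ∀ s' : ℕ, s ≤ s' →
      Real.sqrt ((2 * (2 : ℝ) ^ (-(walshSupExponent * (s' : ℝ)))) ^ 2) ≤ 2 * (2 : ℝ) ^ (-(1 / 800 * (s : ℝ))) := by
    intro s' hs'
    rw [Real.sqrt_sq (by positivity)]
    refine mul_le_mul_of_nonneg_left (two_rpow_le_two_rpow ?_) (by norm_num)
    have h1 : (s : ℝ) ≤ s' := by exact_mod_cast hs'
    have h2 : 0 ≤ walshSupExponent := walshSupExponent_pos.le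
    nlinarith
  have h14 : (2 : ℝ) ^ ((1 : ℝ) / 4) ≤ 2 := by
    calc (2 : ℝ) ^ ((1 : ℝ) / 4) ≤ (2 : ℝ) ^ (1 : ℝ) := two_rpow_le_two_rpow (by norm_num)
      _ = 2 := Real.rpow_one 2
  have h12 : (2 : ℝ) ^ ((1 : ℝ) / 2) ≤ 2 := by
    calc (2 : ℝ) ^ ((1 : ℝ) / 2) ≤ (2 : ℝ) ^ (1 : ℝ) := two_rpow_le_two_rpow (by norm_num)
      _ = 2 := Real.rpow_one 2
  rcases hK with hK0 | ⟨hKi, hK4⟩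
  · -- the bottom window `K = 0`
    subst hK0
    have hZ := boxSum_sq_typeII_zero_bound T (i := i) (j := j) (ρ := ρ₀) (t := ρ₀) le_rfl hi50 hij α β hαle hβ
    rw [← hXbox] at hZ
    set s₀ : ℕ := (T.filter (fun x => x < i + ρ₀ + 1 + ρ₀)).card with hs₀
    have hss₀ : s ≤ s₀ := by
      rw [hs, hs₀]
      refine Finset.card_le_card fun x hx => ?_
      rw [Finset.mem_filter] at hx ⊢
      exact ⟨hx.1, by omega⟩
    set e : ℝ := (2 * (2 : ℝ) ^ (-(walshSupExponent * (s₀ : ℝ)))) ^ 2 with he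
    have he0 : 0 ≤ e := by rw [he]; positivity
    have hq : (((i + ρ₀ + 1 + ρ₀ : ℕ) : ℝ) + 1) ≤ P := by
      rw [hP]; push_cast
      have : (2 : ℝ) * ρ₀ ≤ j := by exact_mod_cast (by omega : 2 * ρ₀ ≤ j)
      linarith
    -- `X ≤ 2^i 2^j (q+1) √Ψ`
    have h1 : X ≤ (2 : ℝ) ^ i * 2 ^ j * (P * (24 * (2 : ℝ) ^ (-((ρ₀ : ℝ) / 4)) +
        6 * (2 : ℝ) ^ ((57 / 2) * (ρ₀ : ℝ)) * Real.sqrt e)) := by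
      have hZ' : X ^ 2 ≤ 4 ^ (i + j) * ((((i + ρ₀ + 1 + ρ₀ : ℕ) : ℝ) + 1) ^ 2 *
          (324 / 2 ^ (ρ₀ / 2) + 24 / 2 ^ ρ₀ + 48 * 2 ^ ρ₀ / 2 ^ j + 32 * 2 ^ (54 * ρ₀ + 3 * ρ₀) * e)) := by
        rw [he]; refine hZ.trans (le_of_eq ?_); ring
      refine (le_of_sq_le_four_pow hX0 hZ').trans (mul_le_mul_of_nonneg_left ?_ (by positivity))
      rw [Real.sqrt_mul (sq_nonneg _), Real.sqrt_sq (by positivity)]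
      exact mul_le_mul hq (zero_case_sqrt_le hρ₀1 hj50 he0) (Real.sqrt_nonneg _) (by linarith)
    -- the savings
    have h2 : 24 * (2 : ℝ) ^ (-((ρ₀ : ℝ) / 4)) + 6 * (2 : ℝ) ^ ((57 / 2) * (ρ₀ : ℝ)) * Real.sqrt e ≤ 48 * (E1 + E3) := by
      have t1 : 24 * (2 : ℝ) ^ (-((ρ₀ : ℝ) / 4)) ≤ 48 * E1 := by
        have := mul_le_mul_of_nonneg_left (hsave1.trans (mul_le_mul_of_nonneg_right h14 hE10)) (by norm_num : (0:ℝ) ≤ 24)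
        linarith
      have t2 : 6 * (2 : ℝ) ^ ((57 / 2) * (ρ₀ : ℝ)) * Real.sqrt e ≤ 12 * E3 := by
        have h3 : Real.sqrt e ≤ 2 * (2 : ℝ) ^ (-(1 / 800 * (s : ℝ))) := by rw [he]; exact hsqrt_e s₀ hss₀
        have h4 : (2 : ℝ) ^ ((57 / 2) * (ρ₀ : ℝ)) * (2 : ℝ) ^ (-(1 / 800 * (s : ℝ))) ≤ E3 := by
          rw [two_rpow_mul_two_rpow, hE3]; exact two_rpow_le_two_rpow (by linarith)
        calc 6 * (2 : ℝ) ^ ((57 / 2) * (ρ₀ : ℝ)) * Real.sqrt e ≤ 6 * (2 : ℝ) ^ ((57 / 2) * (ρ₀ : ℝ)) * (2 * (2 : ℝ) ^ (-(1 / 800 * (s : ℝ)))) :=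
              mul_le_mul_of_nonneg_left h3 (by positivity)
          _ = 12 * ((2 : ℝ) ^ ((57 / 2) * (ρ₀ : ℝ)) * (2 : ℝ) ^ (-(1 / 800 * (s : ℝ)))) := by ring
          _ ≤ 12 * E3 := mul_le_mul_of_nonneg_left h4 (by norm_num)
      have h5 : 0 ≤ E3 := hE30
      linarith
    calc X ≤ (2 : ℝ) ^ i * 2 ^ j * (P * (24 * (2 : ℝ) ^ (-((ρ₀ : ℝ) / 4)) +
          6 * (2 : ℝ) ^ ((57 / 2) * (ρ₀ : ℝ)) * Real.sqrt e)) := h1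
      _ ≤ (2 : ℝ) ^ i * 2 ^ j * (P * (48 * (E1 + E3))) := by
          refine mul_le_mul_of_nonneg_left (mul_le_mul_of_nonneg_left h2 (by linarith)) (by positivity)
      _ ≤ (2 : ℝ) ^ i * 2 ^ j * (P * (48 * (E1 + E2 + E3))) := by
          have : E1 + E3 ≤ E1 + E2 + E3 := by linarith
          gcongr
      _ = ((2 : ℝ) ^ (16 - 11) * (3 / 2) * P ^ 1) * 2 ^ (i + j) * (E1 + E2 + E3) := by rw [h2ij]; norm_num; ring
      _ ≤ ((2 : ℝ) ^ (16 - 1) * P ^ 1) * 2 ^ (i + j) * (E1 + E2 + E3) := by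
          refine mul_le_mul_of_nonneg_right (mul_le_mul_of_nonneg_right ?_ (by positivity)) (by positivity)
          refine mul_le_mul_of_nonneg_right ?_ (by positivity)
          norm_num
      _ ≤ P ^ (16 : ℕ) * 2 ^ (i + j) * (E1 + E2 + E3) := by
          refine mul_le_mul_of_nonneg_right (mul_le_mul_of_nonneg_right (hPpow 1 (by norm_num)) (by positivity)) (by positivity)
  · -- a shifted window: run the estimate on `[K', K'+i+2ρ₀+1)`, `K' = K - 2ρ₀ - 1`
    set K' : ℕ := K - (2 * ρ₀ + 1) with hK'
    have hK'K : K' + (2 * ρ₀ + 1) = K := by rw [hK']; omega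
    have hKlo : 2 * ρ₀ + 2 ≤ K' := by omega
    have hKmid : 9 * i + 80 * ρ₀ ≤ 10 * K' := by omega
    have hKhi : K' + 3 * ρ₀ ≤ j := by omega
    have hH := boxSum_sq_typeII_high_bound T (i := i) (j := j) (ρ := ρ₀) (K := K') (t := ρ₀) hρ₀1 le_rfl
      hi60 hij hj170 hKlo hKmid hKhi α β hαle hβ
    rw [← hXbox] at hH
    set s₁ : ℕ := (T.filter (fun x => K' ≤ x ∧ x < K' + (i + ρ₀ + 1 + ρ₀))).card with hs₁
    have hss₁ : s ≤ s₁ := by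
      rw [hs, hs₁]
      refine Finset.card_le_card fun x hx => ?_
      rw [Finset.mem_filter] at hx ⊢
      exact ⟨hx.1, by omega, by omega⟩
    set e : ℝ := (2 * (2 : ℝ) ^ (-(walshSupExponent * (s₁ : ℝ)))) ^ 2 with he
    have he0 : 0 ≤ e := by rw [he]; positivity
    have h1 : X ≤ (2 : ℝ) ^ i * 2 ^ j * (2 ^ 12 * P ^ 2 * ((2 : ℝ) ^ (-((ρ₀ : ℝ) / 2)) +
        (2 : ℝ) ^ ((165 / 2) * (ρ₀ : ℝ)) * Real.sqrt e)) := by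
      have hH' : X ^ 2 ≤ 4 ^ (i + j) * (2 ^ 20 * ((i : ℝ) + j + ρ₀ + ρ₀ + 4) ^ 3 * (1 / 2 ^ ρ₀ + 2 ^ (165 * ρ₀) * e)) := by
        rw [he]; exact hH
      refine (le_of_sq_le_four_pow hX0 hH').trans (mul_le_mul_of_nonneg_left ?_ (by positivity))
      rw [hP]; exact high_case_sqrt_le h2ρij he0
    have h2 : (2 : ℝ) ^ (-((ρ₀ : ℝ) / 2)) + (2 : ℝ) ^ ((165 / 2) * (ρ₀ : ℝ)) * Real.sqrt e ≤ 2 * (E1 + E3) := by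
      have t1 : (2 : ℝ) ^ (-((ρ₀ : ℝ) / 2)) ≤ 2 * E1 := hsave2.trans (mul_le_mul_of_nonneg_right h12 hE10)
      have h3 : Real.sqrt e ≤ 2 * (2 : ℝ) ^ (-(1 / 800 * (s : ℝ))) := by rw [he]; exact hsqrt_e s₁ hss₁
      have h4 : (2 : ℝ) ^ ((165 / 2) * (ρ₀ : ℝ)) * (2 * (2 : ℝ) ^ (-(1 / 800 * (s : ℝ)))) ≤ 2 * E3 := by
        rw [mul_left_comm, two_rpow_mul_two_rpow, hE3]
        exact mul_le_mul_of_nonneg_left (two_rpow_le_two_rpow (by linarith)) (by norm_num)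
      have t2 := (mul_le_mul_of_nonneg_left h3 (by positivity : (0 : ℝ) ≤ (2 : ℝ) ^ ((165 / 2) * (ρ₀ : ℝ)))).trans h4
      linarith
    calc X ≤ (2 : ℝ) ^ i * 2 ^ j * (2 ^ 12 * P ^ 2 * ((2 : ℝ) ^ (-((ρ₀ : ℝ) / 2)) +
          (2 : ℝ) ^ ((165 / 2) * (ρ₀ : ℝ)) * Real.sqrt e)) := h1
      _ ≤ (2 : ℝ) ^ i * 2 ^ j * (2 ^ 12 * P ^ 2 * (2 * (E1 + E3))) := by
          refine mul_le_mul_of_nonneg_left (mul_le_mul_of_nonneg_left h2 (by positivity)) (by positivity)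
      _ ≤ (2 : ℝ) ^ i * 2 ^ j * (2 ^ 12 * P ^ 2 * (2 * (E1 + E2 + E3))) := by
          have : E1 + E3 ≤ E1 + E2 + E3 := by linarith
          gcongr
      _ = ((2 : ℝ) ^ (16 - 3) * P ^ 2) * 2 ^ (i + j) * (E1 + E2 + E3) := by rw [h2ij]; norm_num; ring
      _ ≤ ((2 : ℝ) ^ (16 - 2) * P ^ 2) * 2 ^ (i + j) * (E1 + E2 + E3) := by
          gcongr
          · norm_num
          · norm_num
      _ ≤ P ^ (16 : ℕ) * 2 ^ (i + j) * (E1 + E2 + E3) := by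
          refine mul_le_mul_of_nonneg_right (mul_le_mul_of_nonneg_right (hPpow 2 (by norm_num)) (by positivity)) (by positivity)

end Literature.NumberTheory.LFunctions.MoebiusWalshTypeII

/-! ### Discharge of the named fact for the Liouville function -/

namespace Literature.NumberTheory.LFunctions

/-- **Bourgain 2013, Theorem 1 for the Liouville function — PROVED** (discharge of the named fact
`bourgain_liouville_walsh_uniform` of `MoebiusWalshCircuits.lean`): for all sufficiently large `n`
and every `A ⊆ {0,…,n-1}`, `|∑_{x<2ⁿ} λ(x) w_A(x)| < 2^{n - n^{1/10}}`. The tree's synthesis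
`LiouvilleWalsh.bourgain_liouville_walsh_uniform_of_typeII` (Green's estimate for small weights,
the Vaughan-type reduction, the type-I estimates of §3 and the numerics of (3.10)) applied to the
per-box type-II estimate `MoebiusWalshTypeII.typeII_perBox` (§2).
[cite: Bourgain2013MoebiusWalsh, Theorem 1 (remark on λ)] -/
theorem bourgain_liouville_walsh_uniform_holds : bourgain_liouville_walsh_uniform :=
  LiouvilleWalsh.bourgain_liouville_walsh_uniform_of_typeII MoebiusWalshTypeII.typeII_perBox

end Literature.NumberTheory.LFunctions

end
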